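import Literature.Analysis.FluidPDE.FractionalGronwall
import HarnessLib

/-!
# The resolvent of the lacunary Volterra kernel `c (t-s)^{-1/2} ‖v(s)‖_∞` on power profiles

Analysis/FluidPDE support file (pure real analysis; everything proved, no definitions of
mathematical objects beyond the bookkeeping operators below, no named facts) on the proof path
of the perturbation theorem of M. P. Coiculescu, S. Palasek, *Non-uniqueness of smooth solutions
of the Navier–Stokes equations from critical data*, Invent. Math. 244 (2025), arXiv:2503.14699,
Props. 4.2–4.3 (the corrected form `κ ≤ α` carried as hypothesis `hB` of
`Literature.Barriers.NavierStokesRegularity.CoiculescuPalasek2025_construction_of_parts'`).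

## What is proved, and why it is the whole of Prop. 4.2 at the level of sup norms

In the mild formulation, the correction `w` of Prop. 4.3 solves
`w = 𝒟[F] - 𝒟[2v ⊙ w] - 𝒟[w ⊗ w]`, `𝒟[G](t) = ∫₀ᵗ e^{(t-τ)Δ}P∇·G(τ) dτ`, and every sup-norm estimate
of the Picard iteration is majorised, slice by slice (`‖e^{σΔ}P∇·(a ⊗ b)‖_∞ ≤ C₀σ^{-1/2}‖a‖_∞‖b‖_∞`),
by the scalar **Volterra operator**

  `(K f)(t) = ∫_{(0,t)} c (t - s)^{-1/2} ν(s) f(s) ds`,   `ν(s) = ‖v(s)‖_{L^∞}` (+ a small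
  correction), `c = 2C₀`,

acting on nonnegative profiles `f : (0,T] → [0,∞]` (`LacunaryVolterra.volterraK`, in `ℝ≥0∞`, so
that no integrability bookkeeping is needed). The datum `𝒟[F]` has the profile
`p_a(t) = t^{a-1/2}` (`a = α`, from `‖F(τ)‖_∞ ≤ ε₀ τ^{-1+α}`), and the convergence of the iteration
with the right weight is exactly the statement that the **resolvent** `Σₙ Kⁿ` is bounded on this
profile:

  `Σ_{n<N} (Kⁿ p_a)(t) ≤ C_R t^{a-1/2}`  for all `N` and `t ∈ (0, T]`
  (`LacunaryVolterra.sum_iterate_volterraK_powProfile_le`),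

with `C_R` depending only on `c`, `a`, the Koch–Tataru constant `K₀` of (3.13a) (`√s ν(s) ≤ K₀`)
and the constant `C` of the lacunarity bound (3.13b)
(`∫_{t₁}^{t₂} (ν² + s^{-1/2}ν) ds ≤ C(1 + η log(t₂/t₁))`), provided the slope `η` is small:
`(θ₀ + 1) η ≤ a/2`, `θ₀ = 3c(1 + 2731c²K₀)C`. This is the content of Prop. 4.2 of the paper (the
semigroup bound `‖S(t,t')a‖_{L^∞} ≲ t^{-1/2}(t')^{-1+α}(t/t')^{ε/2}‖a‖_Y` with the loss exponent
`ε = O(1/log A)` made smaller than the subcriticality window) in the form consumed by the fixed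
point argument of Prop. 4.3 (`‖T(w)(t)‖_{L^∞} ≲ t^{-1/2+ε}∫₀ᵗ(t')^{-1+α-ε}dt' (…) ≲ t^{-1/2+α}(…)`).
The operator `K` is NOT a contraction in the weighted sup norm (its norm is `~ cK₀ B(1/2,a)`,
large); boundedness of the resolvent is a Volterra (causality) phenomenon driven by the
lacunarity of `v`, and the proof is the printed one:

1. **Entry-time chains** (`LacunaryVolterra.chain n t' t = (Kⁿ f_{t'})(t)`,
   `f_{t'}(t) = (t - t')^{-1/2} 1_{t' < t}`): the response to forcing entering at time `t'`.
   Superposition (Tonelli): `Kⁿ(∫ f_{t'} w(t') dt') = ∫ (Kⁿ f_{t'}) w(t') dt'`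
   (`volterraK_superpos`), and `p_a ≤ ∫ f_{t'} (t')^{a-1} dt'` (`powProfile_le_superpos`).
2. **Per entry time, the fractional Grönwall inequality** (the tree's
   `fractional_gronwall`, Lemma B.3 of the paper with `p = 3`): with
   `q_N = Σ_{1≤n≤N} Kⁿ f_{t'}` one has `q_N ≤ K f_{t'} + K q_N`; the first Duhamel iterate obeys
   `t^{1/2}(K f_{t'})(t) ≤ c(10K₀ + √2 C(1 + η log(t/t')))` ((3.13a) on `[t', 2t']`, (3.13b) on
   `[2t', t]`, and `∫_{t'}^{t}(t-s)^{-1/2}(s-t')^{-1/2} ≤ 8`), and for `h = t^{1/2} q_N` the kernel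
   becomes `c ν(s)((t-s)^{-1/2} + s^{-1/2})` because `√t ≤ √s + √(t-s)` — precisely the form
   "`h(t) ≲ (…) + ∫_{t'}^t (s^{-1/2} + (t-s)^{-1/2})‖v(s)‖_{L^∞} h(s) ds`" of the printed proof, to
   which Lemma B.3 is applied with `g₁ = c s^{-1/2}ν`, `g₂ = cν`, `‖s^{1/2}g₂‖_∞ ≤ cK₀`; the
   exponent `O(∫ g₁ + ‖s^{1/2}g₂‖_∞ ∫ g₂²)` is `≤ θ₀(1 + η log(t/t'))` "By (3.13a)–(3.13b)", whence
   `q_N(t) ≤ Λ t^{-1/2} (t/t')^{(θ₀+1)η}` (`sum_chain_succ_le`).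
3. **Integration over the entry time** against `(t')^{a-1}` with the Abel–Beta bounds of the
   tree (`setIntegral_abel_rpow_rpow_le`): `∫₀ᵗ ((t-t')^{-1/2} + Λt^{-1/2}(t/t')^{ε})(t')^{a-1}dt'
   ≤ (2/a + 4 + 2Λ/a) t^{a-1/2}` when `ε ≤ a/2`.

## Mathlib / tree search

Tree: `fractional_gronwall`, `setIntegral_abel_rpow_rpow_le`, `setIntegral_Ioo_sub_rpow_neg`
(`FractionalGronwall.lean`), `integrableOn_sub_rpow_Ioo`, `integrableOn_rpow_Ioo`,
`setIntegral_Ioo_rpow_neg` (`LerayVolterraComparison.lean`). Mathlib: `lintegral_lintegral_swap`,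
`Measurable.lintegral_prod_right'`, `ofReal_integral_eq_lintegral_ofReal`,
`integral_eq_lintegral_of_nonneg_ae`, `Real.log_le_sub_one_of_pos`. No Volterra resolvent /
Neumann-series lemma exists in either (`lean search 'Volterra|resolvent kernel|Neumann series'`).

## References

* M. P. Coiculescu, S. Palasek, Invent. Math. 244 (2025) 165–219 = arXiv:2503.14699: Prop. 3.13
  (3.13a)–(3.13b), §4.2 Prop. 4.2 and its proof, §4.3 proof of Prop. 4.3, App. B Lemma B.3.
  [CoiculescuPalasek2025]
-/

noncomputable section

open MeasureTheory Set Filter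
open _root_.Topology
open scoped ENNReal NNReal

namespace Literature.Analysis.FluidPDE

namespace LacunaryVolterra

/-! ## The kernel, the Volterra operator, entry-time chains -/

/-- The lacunary Volterra kernel `k(t, s) = c (t - s)^{-1/2} ν(s)`, in `ℝ≥0∞`.
[cite: CoiculescuPalasek2025, proof of Prop. 4.2 (the kernel of the Duhamel term II + III)] -/
def kern (c : ℝ) (ν : ℝ → ℝ) (t s : ℝ) : ℝ≥0∞ :=
  ENNReal.ofReal (c * (t - s) ^ (-(1 / 2 : ℝ)) * ν s)

/-- The Volterra operator `(K f)(t) = ∫_{(0,t)} c (t - s)^{-1/2} ν(s) f(s) ds` on `ℝ≥0∞`-valued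
profiles. [cite: CoiculescuPalasek2025, proof of Prop. 4.2] -/
def volterraK (c : ℝ) (ν : ℝ → ℝ) (f : ℝ → ℝ≥0∞) (t : ℝ) : ℝ≥0∞ :=
  ∫⁻ s in Ioo 0 t, kern c ν t s * f s

/-- The entry-time chains `chain n t' t = (Kⁿ f_{t'})(t)`, `f_{t'}(t) = (t - t')^{-1/2} 1_{t' < t}`:
the `n`-th Duhamel iterate of forcing entering at time `t'`.
[cite: CoiculescuPalasek2025, proof of Prop. 4.2 (the semigroup S(t,t'))] -/
def chain (c : ℝ) (ν : ℝ → ℝ) : ℕ → ℝ → ℝ → ℝ≥0∞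
  | 0, t', t => if t' < t then ENNReal.ofReal ((t - t') ^ (-(1 / 2 : ℝ))) else 0
  | n + 1, t', t => volterraK c ν (chain c ν n t') t

/-- The power profile `p_a(t) = t^{a - 1/2}` (in `ℝ≥0∞`; meaningful for `t > 0`). [folklore] -/
def powProfile (a : ℝ) (t : ℝ) : ℝ≥0∞ := ENNReal.ofReal (t ^ (a - 1 / 2))

/-- The superposition `∫_{(0,t)} chain n t' t · w(t') dt'` of entry-time chains against a weight.
[folklore] -/
def superpos (c : ℝ) (ν : ℝ → ℝ) (n : ℕ) (w : ℝ → ℝ≥0∞) (t : ℝ) : ℝ≥0∞ :=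
  ∫⁻ t' in Ioo 0 t, chain c ν n t' t * w t'

variable {c : ℝ} {ν : ℝ → ℝ}

/-- Unfolding of the zeroth chain `f_{t'}(t) = (t - t')^{-1/2} 1_{t'<t}`. [folklore] -/
@[simp] theorem chain_zero (t' t : ℝ) :
    chain c ν 0 t' t = if t' < t then ENNReal.ofReal ((t - t') ^ (-(1 / 2 : ℝ))) else 0 := rfl

/-- Unfolding of the successor chain `chain (n+1) t' = K (chain n t')`. [folklore] -/
@[simp] theorem chain_succ (n : ℕ) (t' t : ℝ) :
    chain c ν (n + 1) t' t = volterraK c ν (chain c ν n t') t := rfl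

/-! ## Monotonicity, support, measurability -/

/-- `K` is monotone, and `(K f)(t)` only sees `f` on `(0, t)`. [folklore] -/
theorem volterraK_mono_on {f g : ℝ → ℝ≥0∞} {t : ℝ} (h : ∀ s ∈ Ioo 0 t, f s ≤ g s) :
    volterraK c ν f t ≤ volterraK c ν g t :=
  setLIntegral_mono' measurableSet_Ioo fun s hs => mul_le_mul' le_rfl (h s hs)

/-- `K` is monotone on profiles compared on `(0, ∞)`. [folklore] -/
theorem volterraK_mono {f g : ℝ → ℝ≥0∞} (h : ∀ s, 0 < s → f s ≤ g s) (t : ℝ) :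
    volterraK c ν f t ≤ volterraK c ν g t :=
  volterraK_mono_on fun s hs => h s hs.1

/-- `(K f)(t)` depends only on `f` restricted to `(0, t)`. [folklore] -/
theorem volterraK_congr_on {f g : ℝ → ℝ≥0∞} {t : ℝ} (h : ∀ s ∈ Ioo 0 t, f s = g s) :
    volterraK c ν f t = volterraK c ν g t :=
  setLIntegral_congr_fun measurableSet_Ioo fun s hs => by rw [h s hs]

/-- Iterates of `K` are monotone on profiles compared on `(0, ∞)`. [folklore] -/
theorem iterate_volterraK_mono {f g : ℝ → ℝ≥0∞} (h : ∀ s, 0 < s → f s ≤ g s) (n : ℕ) :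
    ∀ t, 0 < t → (volterraK c ν)^[n] f t ≤ (volterraK c ν)^[n] g t := by
  induction n with
  | zero => exact h
  | succ n ih =>
    intro t ht
    rw [Function.iterate_succ_apply', Function.iterate_succ_apply']
    exact volterraK_mono ih t

/-- `(K f)(t) = 0` for `t ≤ 0`. [folklore] -/
theorem volterraK_of_nonpos {f : ℝ → ℝ≥0∞} {t : ℝ} (ht : t ≤ 0) : volterraK c ν f t = 0 := by
  rw [volterraK, Ioo_eq_empty (not_lt.2 ht), Measure.restrict_empty, lintegral_zero_measure]

/-- The chains vanish before the entry time: `chain n t' t = 0` for `t ≤ t'`. [folklore] -/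
theorem chain_eq_zero_of_le (n : ℕ) {t' t : ℝ} (h : t ≤ t') : chain c ν n t' t = 0 := by
  induction n generalizing t with
  | zero => simp [not_lt.2 h]
  | succ n ih =>
    rw [chain_succ, volterraK]
    refine (setLIntegral_congr_fun measurableSet_Ioo (g := fun _ => 0) fun s hs => ?_).trans
      lintegral_zero
    simp [ih (hs.2.le.trans h)]

/-- Joint measurability of the kernel. [folklore] -/
theorem measurable_kern (hν : Measurable ν) (c : ℝ) :
    Measurable fun p : ℝ × ℝ => kern c ν p.1 p.2 := by
  unfold kern
  refine Measurable.ennreal_ofReal ?_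
  exact ((measurable_const.mul ((measurable_fst.sub measurable_snd).pow_const _)).mul
    (hν.comp measurable_snd))

/-- Parametric measurability of the Volterra operator: if `G(p, s)` is jointly measurable then
`(p, t) ↦ (K G(p, ·))(t)` is jointly measurable. [folklore] -/
theorem measurable_volterraK_param {α : Type*} [MeasurableSpace α] (hν : Measurable ν)
    {G : α × ℝ → ℝ≥0∞} (hG : Measurable G) :
    Measurable fun q : α × ℝ => volterraK c ν (fun s => G (q.1, s)) q.2 := by
  set H : (α × ℝ) × ℝ → ℝ≥0∞ := fun r =>
    if r.2 ∈ Ioo 0 r.1.2 then kern c ν r.1.2 r.2 * G (r.1.1, r.2) else 0 with hH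
  have hHm : Measurable H := by
    refine Measurable.ite ?_ ?_ measurable_const
    · show MeasurableSet {r : (α × ℝ) × ℝ | r.2 ∈ Ioo 0 r.1.2}
      have : {r : (α × ℝ) × ℝ | r.2 ∈ Ioo 0 r.1.2} = {r | (0 : ℝ) < r.2} ∩ {r | r.2 < r.1.2} := by
        ext r; simp [Ioo]
      rw [this]
      exact (measurableSet_lt measurable_const measurable_snd).inter
        (measurableSet_lt measurable_snd (measurable_snd.comp measurable_fst))
    · exact ((measurable_kern hν c).comp
        ((measurable_snd.comp measurable_fst).prodMk measurable_snd)).mul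
        (hG.comp ((measurable_fst.comp measurable_fst).prodMk measurable_snd))
  have key : ∀ q : α × ℝ, volterraK c ν (fun s => G (q.1, s)) q.2 = ∫⁻ s, H (q, s) := by
    intro q
    rw [volterraK, ← lintegral_indicator measurableSet_Ioo]
    congr 1
    ext s
    simp only [hH, indicator]
  simp_rw [key]
  exact hHm.lintegral_prod_right'

/-- Joint measurability of the entry-time chains in `(t', t)`. [folklore] -/
theorem measurable_chain (hν : Measurable ν) (n : ℕ) :
    Measurable fun q : ℝ × ℝ => chain c ν n q.1 q.2 := by
  induction n with
  | zero =>
    simp only [chain_zero]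
    refine Measurable.ite (measurableSet_lt measurable_fst measurable_snd) ?_ measurable_const
    exact ((measurable_snd.sub measurable_fst).pow_const _).ennreal_ofReal
  | succ n ih =>
    simp only [chain_succ]
    exact measurable_volterraK_param hν (G := fun q : ℝ × ℝ => chain c ν n q.1 q.2) ih

/-- Measurability of the chains in the entry time. [folklore] -/
theorem measurable_chain_left (hν : Measurable ν) (n : ℕ) (t : ℝ) :
    Measurable fun t' => chain c ν n t' t :=
  (measurable_chain hν n).comp (measurable_id.prodMk measurable_const)

/-- Measurability of the chains in the running time. [folklore] -/
theorem measurable_chain_right (hν : Measurable ν) (n : ℕ) (t' : ℝ) :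
    Measurable fun t => chain c ν n t' t :=
  (measurable_chain hν n).comp (measurable_const.prodMk measurable_id)

/-- Measurability of `K f` for measurable `f`. [folklore] -/
theorem measurable_volterraK (hν : Measurable ν) {f : ℝ → ℝ≥0∞} (hf : Measurable f) :
    Measurable (volterraK c ν f) := by
  have h := measurable_volterraK_param (c := c) (α := Unit) hν (G := fun q : Unit × ℝ => f q.2)
    (hf.comp measurable_snd)
  exact h.comp (measurable_prodMk_left (x := ()))

/-- Measurability of the iterates `Kⁿ f`. [folklore] -/
theorem measurable_iterate_volterraK (hν : Measurable ν) {f : ℝ → ℝ≥0∞} (hf : Measurable f)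
    (n : ℕ) : Measurable ((volterraK c ν)^[n] f) := by
  induction n with
  | zero => exact hf
  | succ n ih => rw [Function.iterate_succ']; exact measurable_volterraK hν ih

/-! ## Superposition over the entry time (Tonelli) -/

/-- **Superposition.** `K (∫ chain n t' · w(t') dt') = ∫ chain (n+1) t' · w(t') dt'`: the
Volterra operator commutes with integration over the entry time (Tonelli, the chains being
jointly measurable and vanishing before the entry time). [folklore] -/
theorem volterraK_superpos (hν : Measurable ν) {w : ℝ → ℝ≥0∞} (hw : Measurable w) (n : ℕ)
    (t : ℝ) : volterraK c ν (superpos c ν n w) t = superpos c ν (n + 1) w t := by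
  rcases le_or_gt t 0 with ht | ht
  · rw [volterraK_of_nonpos ht, superpos, Ioo_eq_empty (not_lt.2 ht), Measure.restrict_empty,
      lintegral_zero_measure]
  simp only [volterraK, superpos, chain_succ]
  -- extend the inner domain `(0, s)` to `(0, t)` (the chain vanishes for `t' ≥ s`)
  have h1 : ∀ s ∈ Ioo 0 t, kern c ν t s * ∫⁻ t' in Ioo 0 s, chain c ν n t' s * w t' =
      ∫⁻ t' in Ioo 0 t, kern c ν t s * (chain c ν n t' s * w t') := by
    intro s hs
    rw [lintegral_const_mul' (kern c ν t s) _ ENNReal.ofReal_ne_top]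
    congr 1
    rw [← lintegral_indicator measurableSet_Ioo, ← lintegral_indicator measurableSet_Ioo]
    refine lintegral_congr fun t' => ?_
    by_cases h : t' ∈ Ioo 0 s
    · rw [indicator_of_mem h, indicator_of_mem (show t' ∈ Ioo 0 t from ⟨h.1, h.2.trans hs.2⟩)]
    · rw [indicator_of_notMem h]
      by_cases h' : t' ∈ Ioo 0 t
      · rw [indicator_of_mem h']
        have hst' : s ≤ t' := by
          by_contra hlt
          exact h ⟨h'.1, not_le.1 hlt⟩
        simp [chain_eq_zero_of_le n hst']
      · rw [indicator_of_notMem h']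
  rw [setLIntegral_congr_fun measurableSet_Ioo h1]
  -- Tonelli
  have hF : AEMeasurable (Function.uncurry fun s t' => kern c ν t s * (chain c ν n t' s * w t'))
      ((volume.restrict (Ioo 0 t)).prod (volume.restrict (Ioo 0 t))) := by
    refine Measurable.aemeasurable ?_
    exact ((measurable_kern hν c).comp (measurable_const.prodMk measurable_fst)).mul
      (((measurable_chain hν n).comp (measurable_snd.prodMk measurable_fst)).mul
        (hw.comp measurable_snd))
  rw [lintegral_lintegral_swap hF]
  refine setLIntegral_congr_fun measurableSet_Ioo fun t' _ => ?_
  have hm : Measurable fun s => kern c ν t s * chain c ν n t' s :=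
    ((measurable_kern hν c).comp (measurable_const.prodMk measurable_id)).mul
      (measurable_chain_right hν n t')
  simp_rw [← mul_assoc]
  rw [lintegral_mul_const _ hm]

/-- **Superposition, iterated**: `Kⁿ(∫ f_{t'} w(t') dt') = ∫ (Kⁿ f_{t'}) w(t') dt'`. [folklore] -/
theorem iterate_volterraK_superpos (hν : Measurable ν) {w : ℝ → ℝ≥0∞} (hw : Measurable w)
    (n : ℕ) : (volterraK c ν)^[n] (superpos c ν 0 w) = superpos c ν n w := by
  induction n with
  | zero => rfl
  | succ n ih =>
    rw [Function.iterate_succ_apply', ih]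
    funext t
    exact volterraK_superpos hν hw n t

/-- Measurability of the superpositions. [folklore] -/
theorem measurable_superpos (hν : Measurable ν) {w : ℝ → ℝ≥0∞} (hw : Measurable w) (n : ℕ) :
    Measurable (superpos c ν n w) := by
  induction n with
  | zero =>
    set H : ℝ × ℝ → ℝ≥0∞ := fun r =>
      if r.2 ∈ Ioo 0 r.1 then chain c ν 0 r.2 r.1 * w r.2 else 0 with hH
    have hHm : Measurable H := by
      refine Measurable.ite ?_ ?_ measurable_const
      · show MeasurableSet {r : ℝ × ℝ | r.2 ∈ Ioo 0 r.1}
        have : {r : ℝ × ℝ | r.2 ∈ Ioo 0 r.1} = {r | (0 : ℝ) < r.2} ∩ {r | r.2 < r.1} := by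
          ext r; simp [Ioo]
        rw [this]
        exact (measurableSet_lt measurable_const measurable_snd).inter
          (measurableSet_lt measurable_snd measurable_fst)
      · exact ((measurable_chain (c := c) hν 0).comp (measurable_snd.prodMk measurable_fst)).mul
          (hw.comp measurable_snd)
    have key : ∀ t, superpos c ν 0 w t = ∫⁻ t', H (t, t') := by
      intro t
      rw [superpos, ← lintegral_indicator measurableSet_Ioo]
      congr 1
      funext t'
      rw [Set.indicator_apply]
    rw [show superpos c ν 0 w = fun t => superpos c ν 0 w t from rfl]
    simp_rw [key]
    exact hHm.lintegral_prod_right'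
  | succ n ih =>
    have h := iterate_volterraK_superpos (c := c) hν hw (n + 1)
    rw [← h, Function.iterate_succ_apply', iterate_volterraK_superpos hν hw n]
    exact measurable_volterraK hν ih

/-! ## Linearity of `K` -/

/-- Additivity of `K`. [folklore] -/
theorem volterraK_add {f g : ℝ → ℝ≥0∞} (hν : Measurable ν) (hf : Measurable f) (t : ℝ) :
    volterraK c ν (f + g) t = volterraK c ν f t + volterraK c ν g t := by
  simp only [volterraK, Pi.add_apply, mul_add]
  exact lintegral_add_left (((measurable_kern hν c).comp
    (measurable_const.prodMk measurable_id)).mul hf) _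

/-- `K` commutes with finite sums of measurable profiles. [folklore] -/
theorem volterraK_finset_sum (hν : Measurable ν) {ι : Type*} (S : Finset ι) {f : ι → ℝ → ℝ≥0∞}
    (hf : ∀ i ∈ S, Measurable (f i)) (t : ℝ) :
    volterraK c ν (fun s => ∑ i ∈ S, f i s) t = ∑ i ∈ S, volterraK c ν (f i) t := by
  simp only [volterraK, Finset.mul_sum]
  exact lintegral_finsetSum' S fun i hi => ((((measurable_kern hν c).comp
    (measurable_const.prodMk measurable_id)).mul (hf i hi)).aemeasurable)

/-- **The resolvent recursion per entry time** (the "`q`-trick"): for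
`q_N = Σ_{1≤n≤N} Kⁿ f_{t'}` one has `q_N ≤ K f_{t'} + K q_N` (monotonicity in `N` of the partial
sums). [cite: CoiculescuPalasek2025, proof of Prop. 4.2 (Duhamel formula for S(t,t'))] -/
theorem sum_chain_succ_le_add (hν : Measurable ν) (N : ℕ) (t' t : ℝ) :
    ∑ m ∈ Finset.range N, chain c ν (m + 1) t' t ≤
      chain c ν 1 t' t +
        volterraK c ν (fun s => ∑ m ∈ Finset.range N, chain c ν (m + 1) t' s) t := by
  cases N with
  | zero => simp
  | succ M =>
    have h1 : ∑ m ∈ Finset.range (M + 1), chain c ν (m + 1) t' t =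
        volterraK c ν (fun s => ∑ m ∈ Finset.range (M + 1), chain c ν m t' s) t := by
      simp only [chain_succ]
      rw [volterraK_finset_sum hν _ fun m _ => measurable_chain_right hν m t']
    have h2 : (fun s => ∑ m ∈ Finset.range (M + 1), chain c ν m t' s) =
        (fun s => chain c ν 0 t' s) + fun s => ∑ m ∈ Finset.range M, chain c ν (m + 1) t' s := by
      funext s
      rw [Finset.sum_range_succ']
      simp only [Pi.add_apply]
      ring
    rw [h1, h2, volterraK_add hν (measurable_chain_right hν 0 t'), ← chain_succ]
    gcongr
    refine volterraK_mono (fun s _ => ?_) t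
    exact Finset.sum_le_sum_of_subset (by simp)

/-! ## Elementary integrals -/

/-- `∫_{(t',t)} (t - s)^{-1/2}(s - t')^{-1/2} ds ≤ 8` (change of variables to the tree's two-sided
Abel–Beta bound; the exact value is `π`). [folklore] -/
theorem setIntegral_sub_rpow_mul_sub_rpow_le {t' t : ℝ} (h : t' < t) :
    IntegrableOn (fun s : ℝ => (t - s) ^ (-(1 / 2 : ℝ)) * (s - t') ^ (-(1 / 2 : ℝ))) (Ioo t' t) ∧
      ∫ s in Ioo t' t, (t - s) ^ (-(1 / 2 : ℝ)) * (s - t') ^ (-(1 / 2 : ℝ)) ≤ 8 := by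
  have hL : 0 < t - t' := sub_pos.2 h
  obtain ⟨hint, hle⟩ := setIntegral_abel_rpow_rpow_le (a := 1 / 2) (b := 1 / 2) (t := t - t')
    (by norm_num) (by norm_num) (by norm_num) (by norm_num) hL
  set g : ℝ → ℝ := fun u => (t - t' - u) ^ (-(1 / 2 : ℝ)) * u ^ (-(1 / 2 : ℝ)) with hg
  have hfg : (fun s : ℝ => (t - s) ^ (-(1 / 2 : ℝ)) * (s - t') ^ (-(1 / 2 : ℝ))) =
      fun s => g (s - t') := by
    funext s
    simp only [hg]
    congr 2
    ring
  rw [hfg]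
  have hgi : IntervalIntegrable g volume 0 (t - t') :=
    (intervalIntegrable_iff_integrableOn_Ioo_of_le hL.le).2 hint
  have hgi' := hgi.comp_sub_right t'
  rw [zero_add, sub_add_cancel] at hgi'
  refine ⟨(intervalIntegrable_iff_integrableOn_Ioo_of_le h.le).1 hgi', ?_⟩
  rw [← integral_Ioc_eq_integral_Ioo, ← intervalIntegral.integral_of_le h.le,
    intervalIntegral.integral_comp_sub_right g t', sub_self,
    intervalIntegral.integral_of_le hL.le, integral_Ioc_eq_integral_Ioo]
  calc ∫ u in Ioo 0 (t - t'), g u ≤ (2 / (1 - 1 / 2) + 2 / (1 - 1 / 2)) * (t - t') ^ (1 - 1 / 2 - 1 / 2 : ℝ) :=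
        hle
    _ = 8 := by norm_num

/-- The lower Abel bound behind `p_a ≤ ∫ f_{t'} (t')^{a-1} dt'`:
`t^{a-1/2} ≤ ∫_{(0,t)} (t - t')^{-1/2} (t')^{a-1} dt'` in `ℝ≥0∞` (restrict to `(t/2, t)`, where
`(t')^{a-1} ≥ t^{a-1}`, and `∫_{(t/2,t)}(t-t')^{-1/2} = 2(t/2)^{1/2} ≥ t^{1/2}`). [folklore] -/
theorem powProfile_le_superpos {a : ℝ} (ha : a ≤ 1) {t : ℝ} (ht : 0 < t) :
    powProfile a t ≤ superpos c ν 0 (fun t' => ENNReal.ofReal (t' ^ (a - 1))) t := by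
  have ht2 : 0 < t / 2 := by positivity
  have hsub : Ioo (t / 2) t ⊆ Ioo 0 t := Ioo_subset_Ioo ht2.le le_rfl
  -- the integral of the kernel over `(t/2, t)`
  have hI : ∫⁻ t' in Ioo (t / 2) t, ENNReal.ofReal ((t - t') ^ (-(1 / 2 : ℝ))) =
      ENNReal.ofReal ((t - t / 2) ^ (1 - 1 / 2 : ℝ) / (1 - 1 / 2)) := by
    rw [← setIntegral_Ioo_sub_rpow_neg (by linarith) (by norm_num : (1 / 2 : ℝ) < 1),
      ofReal_integral_eq_lintegral_ofReal]
    · exact integrableOn_sub_rpow_Ioo (by norm_num)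
    · exact (ae_restrict_iff' measurableSet_Ioo).2 (Eventually.of_forall fun s hs =>
        Real.rpow_nonneg (by linarith [hs.2]) _)
  have hlow : ENNReal.ofReal (t ^ (a - 1)) * ENNReal.ofReal ((t - t / 2) ^ (1 - 1 / 2 : ℝ) / (1 - 1 / 2)) ≤
      superpos c ν 0 (fun t' => ENNReal.ofReal (t' ^ (a - 1))) t := by
    rw [← hI, ← lintegral_const_mul' _ _ ENNReal.ofReal_ne_top, superpos]
    refine (lintegral_mono_set hsub).trans' ?_
    refine setLIntegral_mono' measurableSet_Ioo fun t' ht' => ?_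
    rw [chain_zero, if_pos ht'.2, mul_comm]
    exact mul_le_mul' le_rfl (ENNReal.ofReal_le_ofReal
      (Real.rpow_le_rpow_of_nonpos (ht2.trans ht'.1) ht'.2.le (by linarith)))
  refine le_trans ?_ hlow
  rw [← ENNReal.ofReal_mul (Real.rpow_nonneg ht.le _), powProfile]
  refine ENNReal.ofReal_le_ofReal ?_
  have h1 : t - t / 2 = t / 2 := by ring
  have h2 : (1 - 1 / 2 : ℝ) = 1 / 2 := by norm_num
  rw [h1, h2]
  have h3 : (t / 2) ^ (1 / 2 : ℝ) = t ^ (1 / 2 : ℝ) * (1 / 2 : ℝ) ^ (1 / 2 : ℝ) := by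
    rw [div_eq_mul_inv, Real.mul_rpow ht.le (by norm_num)]
    norm_num
  have h4 : (1 / 2 : ℝ) ≤ (1 / 2 : ℝ) ^ (1 / 2 : ℝ) := by
    have := Real.rpow_le_rpow_of_exponent_ge (by norm_num : (0 : ℝ) < 1 / 2)
      (by norm_num : (1 / 2 : ℝ) ≤ 1) (by norm_num : (1 / 2 : ℝ) ≤ 1)
    simpa using this
  have h5 : t ^ (a - 1 / 2) = t ^ (a - 1) * t ^ (1 / 2 : ℝ) := by
    rw [← Real.rpow_add ht]; ring_nf
  rw [h5, h3]
  have h6 : 0 ≤ t ^ (a - 1) * t ^ (1 / 2 : ℝ) := by positivity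
  calc t ^ (a - 1) * t ^ (1 / 2 : ℝ) = t ^ (a - 1) * t ^ (1 / 2 : ℝ) * ((1 / 2) / (1 / 2)) := by
        norm_num
    _ ≤ t ^ (a - 1) * t ^ (1 / 2 : ℝ) * ((1 / 2 : ℝ) ^ (1 / 2 : ℝ) / (1 / 2)) := by
        gcongr
    _ = t ^ (a - 1) * (t ^ (1 / 2 : ℝ) * (1 / 2 : ℝ) ^ (1 / 2 : ℝ) / (1 / 2)) := by ring

/-! ## Real-variable estimates for the first iterate and the kernel -/

/-- `√t ≤ √(t - s) + √s`. [folklore] -/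
theorem sqrt_le_sqrt_sub_add_sqrt {s t : ℝ} (hs : 0 ≤ s) (hst : s ≤ t) :
    Real.sqrt t ≤ Real.sqrt (t - s) + Real.sqrt s := by
  rw [Real.sqrt_le_left (by positivity)]
  nlinarith [Real.sq_sqrt (sub_nonneg.2 hst), Real.sq_sqrt hs, Real.sqrt_nonneg (t - s),
    Real.sqrt_nonneg s]

/-- `√(t-s) · (t-s)^{-1/2} = 1` for `s < t`. [folklore] -/
theorem sqrt_mul_rpow_neg_half {x : ℝ} (hx : 0 < x) : Real.sqrt x * x ^ (-(1 / 2 : ℝ)) = 1 := by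
  rw [Real.sqrt_eq_rpow, ← Real.rpow_add hx]
  norm_num

/-- `(s - t')^{r}` is integrable on `(t', t)` for `-1 < r`. [folklore] -/
theorem integrableOn_sub_right_rpow_Ioo {t' t r : ℝ} (hr : -1 < r) :
    IntegrableOn (fun s : ℝ => (s - t') ^ r) (Ioo t' t) := by
  rcases le_or_gt t t' with h | h
  · rw [Ioo_eq_empty (not_lt.2 h)]; exact integrableOn_empty
  have h1 : IntervalIntegrable (fun u : ℝ => u ^ r) volume 0 (t - t') :=
    intervalIntegral.intervalIntegrable_rpow' hr
  have h2 := h1.comp_sub_right t'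
  rw [zero_add, sub_add_cancel] at h2
  exact (intervalIntegrable_iff_integrableOn_Ioo_of_le h.le).1 h2

/-- `(K f)(t)` as an integral over `(t', t)` when `f` vanishes on `(-∞, t']`. [folklore] -/
theorem volterraK_eq_setLIntegral_Ioo {f : ℝ → ℝ≥0∞} {t' : ℝ} (ht' : 0 ≤ t')
    (hf : ∀ s ≤ t', f s = 0) (t : ℝ) :
    volterraK c ν f t = ∫⁻ s in Ioo t' t, kern c ν t s * f s := by
  have h1 : ∫⁻ s in Ioo 0 t, kern c ν t s * f s =
      ∫⁻ s in Ioo 0 t, (Ioi t').indicator (fun s => kern c ν t s * f s) s := by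
    refine setLIntegral_congr_fun measurableSet_Ioo fun s _ => ?_
    by_cases h : s ∈ Ioi t'
    · rw [indicator_of_mem h]
    · rw [indicator_of_notMem h, hf s (not_lt.1 h), mul_zero]
  rw [volterraK, h1, lintegral_indicator measurableSet_Ioi,
    Measure.restrict_restrict measurableSet_Ioi]
  congr 2
  ext s
  simp only [mem_inter_iff, mem_Ioi, mem_Ioo]
  constructor
  · rintro ⟨h1, _, h3⟩; exact ⟨h1, h3⟩
  · rintro ⟨h1, h2⟩; exact ⟨h1, ht'.trans_lt h1, h2⟩

/-- The first iterate in closed form: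
`(K f_{t'})(t) = ∫_{(t',t)} c (t-s)^{-1/2} ν(s) (s-t')^{-1/2} ds`. [folklore] -/
theorem chain_one_eq {t' : ℝ} (ht' : 0 ≤ t') (t : ℝ) :
    chain c ν 1 t' t = ∫⁻ s in Ioo t' t,
      ENNReal.ofReal (c * (t - s) ^ (-(1 / 2 : ℝ)) * ν s * (s - t') ^ (-(1 / 2 : ℝ))) := by
  rw [chain_succ, volterraK_eq_setLIntegral_Ioo ht' (fun s hs => chain_eq_zero_of_le 0 hs)]
  refine setLIntegral_congr_fun measurableSet_Ioo fun s hs => ?_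
  rw [chain_zero, if_pos hs.1, kern,
    ← ENNReal.ofReal_mul' (Real.rpow_nonneg (sub_pos.2 hs.1).le _)]

section Estimates

variable {K₀ C η T : ℝ}

/-- From (3.13a): `0 ≤ ν(s) ≤ K₀ s^{-1/2} ≤ K₀ (t')^{-1/2}` for `t' ≤ s ≤ T`. [folklore] -/
theorem nu_le_of_sqrt_mul_le (hν0 : ∀ s ∈ Ioc 0 T, 0 ≤ ν s)
    (h313a : ∀ s ∈ Ioc 0 T, Real.sqrt s * ν s ≤ K₀) {t' s : ℝ} (ht' : 0 < t')
    (hs : s ∈ Icc t' T) :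
    0 ≤ ν s ∧ ν s ≤ K₀ * s ^ (-(1 / 2 : ℝ)) ∧ ν s ≤ K₀ * t' ^ (-(1 / 2 : ℝ)) := by
  have hs0 : 0 < s := ht'.trans_le hs.1
  have hsT : s ∈ Ioc 0 T := ⟨hs0, hs.2⟩
  have h0 := hν0 s hsT
  have h1 : ν s ≤ K₀ * s ^ (-(1 / 2 : ℝ)) := by
    have h := h313a s hsT
    have hK : 0 ≤ K₀ := le_trans (mul_nonneg (Real.sqrt_nonneg _) h0) h
    calc ν s = (Real.sqrt s * ν s) * s ^ (-(1 / 2 : ℝ)) := by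
          rw [mul_comm (Real.sqrt s), mul_assoc, sqrt_mul_rpow_neg_half hs0, mul_one]
      _ ≤ K₀ * s ^ (-(1 / 2 : ℝ)) :=
          mul_le_mul_of_nonneg_right h (Real.rpow_nonneg hs0.le _)
  refine ⟨h0, h1, h1.trans ?_⟩
  have hK : 0 ≤ K₀ := le_trans (mul_nonneg (Real.sqrt_nonneg _) h0) (h313a s hsT)
  exact mul_le_mul_of_nonneg_left (Real.rpow_le_rpow_of_nonpos ht' hs.1 (by norm_num)) hK

/-- **The lacunary estimate of the first iterate's singular factor**:
`∫_{(t',t)} ν(s)(s-t')^{-1/2} ds ≤ 2K₀ + √2 C(1 + η log(t/t'))` — (3.13a) on `[t', 2t']`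
(`ν ≤ K₀(t')^{-1/2}`, `∫(s-t')^{-1/2} ≤ 2(t')^{1/2}`) and (3.13b) on `[2t', t]`
(`(s-t')^{-1/2} ≤ √2 s^{-1/2}`). [cite: CoiculescuPalasek2025, proof of Prop. 4.2 ("By (3.13a)–(3.13b), we may estimate the norms in the exponent")] -/
theorem setIntegral_nu_mul_sub_rpow_le (hC : 0 ≤ C) (hη : 0 ≤ η) (hνm : Measurable ν)
    (hνc : ContinuousOn ν (Ioc 0 T)) (hν0 : ∀ s ∈ Ioc 0 T, 0 ≤ ν s)
    (h313a : ∀ s ∈ Ioc 0 T, Real.sqrt s * ν s ≤ K₀)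
    (h313b : ∀ t₁ t₂ : ℝ, 0 < t₁ → t₁ ≤ t₂ → t₂ ≤ T →
      ∫ s in t₁..t₂, (ν s ^ 2 + s ^ (-(1 / 2 : ℝ)) * ν s) ≤ C * (1 + η * Real.log (t₂ / t₁)))
    {t' t : ℝ} (ht' : 0 < t') (ht't : t' < t) (htT : t ≤ T) :
    IntegrableOn (fun s => ν s * (s - t') ^ (-(1 / 2 : ℝ))) (Ioo t' t) ∧
      ∫ s in Ioo t' t, ν s * (s - t') ^ (-(1 / 2 : ℝ)) ≤
        2 * K₀ + Real.sqrt 2 * C * (1 + η * Real.log (t / t')) := by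
  have hK : 0 ≤ K₀ := le_trans (mul_nonneg (Real.sqrt_nonneg _) (hν0 t ⟨ht'.trans ht't, htT⟩))
    (h313a t ⟨ht'.trans ht't, htT⟩)
  -- integrability on any `(t', τ)`, `τ ≤ T`, and the bound by `(3.13a)` there
  have hint : ∀ τ, τ ≤ T → IntegrableOn (fun s => ν s * (s - t') ^ (-(1 / 2 : ℝ))) (Ioo t' τ) := by
    intro τ hτ
    refine Integrable.bdd_mul (c := K₀ * t' ^ (-(1 / 2 : ℝ)))
      (integrableOn_sub_right_rpow_Ioo (by norm_num)) (hνm.aestronglyMeasurable) ?_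
    refine (ae_restrict_iff' measurableSet_Ioo).2 (Eventually.of_forall fun s hs => ?_)
    obtain ⟨h0, -, h2⟩ := nu_le_of_sqrt_mul_le hν0 h313a ht' ⟨hs.1.le, hs.2.le.trans hτ⟩
    rw [Real.norm_eq_abs, abs_of_nonneg h0]
    exact h2
  refine ⟨hint t htT, ?_⟩
  -- the bound on a short interval `(t', τ)`, `τ ≤ 2t'`
  have hshort : ∀ τ, t' ≤ τ → τ ≤ 2 * t' → τ ≤ T →
      ∫ s in t'..τ, ν s * (s - t') ^ (-(1 / 2 : ℝ)) ≤ 2 * K₀ := by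
    intro τ h1 h2 h3
    have hmono : ∫ s in t'..τ, ν s * (s - t') ^ (-(1 / 2 : ℝ)) ≤
        ∫ s in t'..τ, K₀ * t' ^ (-(1 / 2 : ℝ)) * (s - t') ^ (-(1 / 2 : ℝ)) := by
      refine intervalIntegral.integral_mono_on h1 ?_ ?_ fun s hs => ?_
      · exact (intervalIntegrable_iff_integrableOn_Ioo_of_le h1).2 (hint τ h3)
      · exact ((intervalIntegrable_iff_integrableOn_Ioo_of_le h1).2
          (integrableOn_sub_right_rpow_Ioo (by norm_num))).const_mul _
      · obtain ⟨-, -, h⟩ := nu_le_of_sqrt_mul_le hν0 h313a ht' ⟨hs.1, hs.2.trans h3⟩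
        exact mul_le_mul_of_nonneg_right h (Real.rpow_nonneg (sub_nonneg.2 hs.1) _)
    refine hmono.trans ?_
    rw [intervalIntegral.integral_const_mul, intervalIntegral.integral_comp_sub_right
      (fun s => s ^ (-(1 / 2 : ℝ))) t', sub_self, integral_rpow (Or.inl (by norm_num))]
    have e1 : (-(1 / 2 : ℝ) + 1) = 1 / 2 := by norm_num
    rw [e1, Real.zero_rpow (by norm_num), sub_zero]
    have h4 : (τ - t') ^ (1 / 2 : ℝ) ≤ t' ^ (1 / 2 : ℝ) :=
      Real.rpow_le_rpow (sub_nonneg.2 h1) (by linarith) (by norm_num)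
    have h5 : t' ^ (-(1 / 2 : ℝ)) * t' ^ (1 / 2 : ℝ) = 1 := by
      rw [← Real.rpow_add ht']; norm_num
    calc K₀ * t' ^ (-(1 / 2 : ℝ)) * ((τ - t') ^ (1 / 2 : ℝ) / (1 / 2))
        = 2 * K₀ * (t' ^ (-(1 / 2 : ℝ)) * (τ - t') ^ (1 / 2 : ℝ)) := by ring
      _ ≤ 2 * K₀ * (t' ^ (-(1 / 2 : ℝ)) * t' ^ (1 / 2 : ℝ)) := by
          gcongr
      _ = 2 * K₀ := by rw [h5, mul_one]
  have hlog0 : 0 ≤ Real.log (t / t') := Real.log_nonneg ((one_le_div ht').2 ht't.le)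
  have hextra : 0 ≤ Real.sqrt 2 * C * (1 + η * Real.log (t / t')) := by positivity
  rw [← integral_Ioc_eq_integral_Ioo, ← intervalIntegral.integral_of_le ht't.le]
  rcases le_or_gt t (2 * t') with h2 | h2
  · exact (hshort t ht't.le h2 htT).trans (le_add_of_nonneg_right hextra)
  -- long interval: split at `2t'`
  have h2t'T : 2 * t' ≤ T := h2.le.trans htT
  have hi1 : IntervalIntegrable (fun s => ν s * (s - t') ^ (-(1 / 2 : ℝ))) volume t' (2 * t') :=
    (intervalIntegrable_iff_integrableOn_Ioo_of_le (by linarith)).2 (hint _ h2t'T)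
  have hi2 : IntervalIntegrable (fun s => ν s * (s - t') ^ (-(1 / 2 : ℝ))) volume (2 * t') t :=
    ((intervalIntegrable_iff_integrableOn_Ioo_of_le ht't.le).2 (hint t htT)).mono_set
      (by rw [uIcc_of_le ht't.le, uIcc_of_le h2.le]; exact Icc_subset_Icc (by linarith) le_rfl)
  rw [← intervalIntegral.integral_add_adjacent_intervals hi1 hi2]
  have hpart1 := hshort (2 * t') (by linarith) le_rfl h2t'T
  -- on `[2t', t]`: `(s - t')^{-1/2} ≤ √2 s^{-1/2}`, then (3.13b)
  have hcont : ContinuousOn (fun s => ν s ^ 2 + s ^ (-(1 / 2 : ℝ)) * ν s) (Icc (2 * t') t) := by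
    have hνc' : ContinuousOn ν (Icc (2 * t') t) :=
      hνc.mono fun s hs => ⟨by linarith [hs.1], hs.2.trans htT⟩
    refine (hνc'.pow 2).add (ContinuousOn.mul ?_ hνc')
    exact ContinuousOn.rpow_const continuousOn_id fun s hs =>
      Or.inl (ne_of_gt (show (0:ℝ) < id s from by simp only [id_eq]; linarith [hs.1]))
  have hpart2 : ∫ s in (2 * t')..t, ν s * (s - t') ^ (-(1 / 2 : ℝ)) ≤
      Real.sqrt 2 * (C * (1 + η * Real.log (t / (2 * t')))) := by
    have hmono : ∫ s in (2 * t')..t, ν s * (s - t') ^ (-(1 / 2 : ℝ)) ≤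
        ∫ s in (2 * t')..t, Real.sqrt 2 * (ν s ^ 2 + s ^ (-(1 / 2 : ℝ)) * ν s) := by
      refine intervalIntegral.integral_mono_on h2.le hi2 ?_ fun s hs => ?_
      · exact (hcont.intervalIntegrable_of_Icc h2.le).const_mul _
      · have hs0 : 0 < s := by linarith [hs.1]
        obtain ⟨hν0s, -, -⟩ := nu_le_of_sqrt_mul_le hν0 h313a ht' ⟨by linarith [hs.1], hs.2.trans htT⟩
        have hcmp : (s - t') ^ (-(1 / 2 : ℝ)) ≤ Real.sqrt 2 * s ^ (-(1 / 2 : ℝ)) := by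
          have h6 : (s - t') ^ (-(1 / 2 : ℝ)) ≤ (s / 2) ^ (-(1 / 2 : ℝ)) :=
            Real.rpow_le_rpow_of_nonpos (by positivity) (by linarith [hs.1]) (by norm_num)
          have h7 : (s / 2) ^ (-(1 / 2 : ℝ)) = Real.sqrt 2 * s ^ (-(1 / 2 : ℝ)) := by
            rw [div_eq_mul_inv, Real.mul_rpow hs0.le (by norm_num), Real.inv_rpow (by norm_num),
              Real.rpow_neg (by norm_num : (0:ℝ) ≤ 2), inv_inv, Real.sqrt_eq_rpow]
            ring
          rw [← h7]; exact h6
        calc ν s * (s - t') ^ (-(1 / 2 : ℝ)) ≤ ν s * (Real.sqrt 2 * s ^ (-(1 / 2 : ℝ))) :=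
              mul_le_mul_of_nonneg_left hcmp hν0s
          _ = Real.sqrt 2 * (s ^ (-(1 / 2 : ℝ)) * ν s) := by ring
          _ ≤ Real.sqrt 2 * (ν s ^ 2 + s ^ (-(1 / 2 : ℝ)) * ν s) := by
              gcongr; nlinarith
    refine hmono.trans ?_
    rw [intervalIntegral.integral_const_mul]
    exact mul_le_mul_of_nonneg_left (h313b _ _ (by linarith) h2.le htT) (Real.sqrt_nonneg _)
  have ht0 : 0 < t := ht'.trans ht't
  have hlogcmp : Real.log (t / (2 * t')) ≤ Real.log (t / t') :=
    Real.log_le_log (by positivity) (div_le_div_of_nonneg_left ht0.le ht' (by linarith))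
  calc (∫ s in t'..(2 * t'), ν s * (s - t') ^ (-(1 / 2 : ℝ))) +
        ∫ s in (2 * t')..t, ν s * (s - t') ^ (-(1 / 2 : ℝ))
      ≤ 2 * K₀ + Real.sqrt 2 * (C * (1 + η * Real.log (t / (2 * t')))) := add_le_add hpart1 hpart2
    _ ≤ 2 * K₀ + Real.sqrt 2 * C * (1 + η * Real.log (t / t')) := by
        rw [mul_assoc]
        gcongr

/-- **The first Duhamel iterate per entry time**:
`t^{1/2} (K f_{t'})(t) ≤ c(10 K₀ + √2 C(1 + η log(t/t')))` (and finiteness), from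
`√t ≤ √(t-s) + √s`, (3.13a) and `setIntegral_nu_mul_sub_rpow_le`.
[cite: CoiculescuPalasek2025, proof of Prop. 4.2 (terms II, III and the weight h(t) = t^{1/2}‖S(t,t')a‖)] -/
theorem sqrt_mul_chain_one_toReal_le (hc : 0 ≤ c) (hC : 0 ≤ C) (hη : 0 ≤ η)
    (hνm : Measurable ν) (hνc : ContinuousOn ν (Ioc 0 T)) (hν0 : ∀ s ∈ Ioc 0 T, 0 ≤ ν s)
    (h313a : ∀ s ∈ Ioc 0 T, Real.sqrt s * ν s ≤ K₀)
    (h313b : ∀ t₁ t₂ : ℝ, 0 < t₁ → t₁ ≤ t₂ → t₂ ≤ T →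
      ∫ s in t₁..t₂, (ν s ^ 2 + s ^ (-(1 / 2 : ℝ)) * ν s) ≤ C * (1 + η * Real.log (t₂ / t₁)))
    {t' t : ℝ} (ht' : 0 < t') (ht't : t' < t) (htT : t ≤ T) :
    chain c ν 1 t' t ≠ ∞ ∧
      Real.sqrt t * (chain c ν 1 t' t).toReal ≤
        c * (10 * K₀ + Real.sqrt 2 * C * (1 + η * Real.log (t / t'))) := by
  have hK : 0 ≤ K₀ := le_trans (mul_nonneg (Real.sqrt_nonneg _) (hν0 t ⟨ht'.trans ht't, htT⟩))
    (h313a t ⟨ht'.trans ht't, htT⟩)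
  set φ : ℝ → ℝ := fun s =>
    c * (t - s) ^ (-(1 / 2 : ℝ)) * ν s * (s - t') ^ (-(1 / 2 : ℝ)) with hφ
  obtain ⟨hab_int, hab_le⟩ := setIntegral_sub_rpow_mul_sub_rpow_le ht't
  have hφ_eq : ∀ s, φ s = (c * ν s) * ((t - s) ^ (-(1 / 2 : ℝ)) * (s - t') ^ (-(1 / 2 : ℝ))) :=
    fun s => by simp only [hφ]; ring
  have hφint : IntegrableOn φ (Ioo t' t) := by
    have h : IntegrableOn (fun s => (c * ν s) * ((t - s) ^ (-(1 / 2 : ℝ)) *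
        (s - t') ^ (-(1 / 2 : ℝ)))) (Ioo t' t) := by
      refine Integrable.bdd_mul (c := c * (K₀ * t' ^ (-(1 / 2 : ℝ)))) hab_int
        ((measurable_const.mul hνm).aestronglyMeasurable) ?_
      refine (ae_restrict_iff' measurableSet_Ioo).2 (Eventually.of_forall fun s hs => ?_)
      obtain ⟨h0, -, h2⟩ := nu_le_of_sqrt_mul_le hν0 h313a ht' ⟨hs.1.le, hs.2.le.trans htT⟩
      rw [Real.norm_eq_abs, abs_of_nonneg (mul_nonneg hc h0)]
      exact mul_le_mul_of_nonneg_left h2 hc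
    exact h.congr_fun (fun s _ => (hφ_eq s).symm) measurableSet_Ioo
  have hφnn : ∀ s ∈ Ioo t' t, 0 ≤ φ s := by
    intro s hs
    obtain ⟨h0, -, -⟩ := nu_le_of_sqrt_mul_le hν0 h313a ht' ⟨hs.1.le, hs.2.le.trans htT⟩
    simp only [hφ]
    exact mul_nonneg (mul_nonneg (mul_nonneg hc (Real.rpow_nonneg (sub_pos.2 hs.2).le _)) h0)
      (Real.rpow_nonneg (sub_pos.2 hs.1).le _)
  have hchain : chain c ν 1 t' t = ENNReal.ofReal (∫ s in Ioo t' t, φ s) := by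
    rw [chain_one_eq ht'.le, ofReal_integral_eq_lintegral_ofReal hφint
      ((ae_restrict_iff' measurableSet_Ioo).2 (Eventually.of_forall hφnn))]
  refine ⟨by rw [hchain]; exact ENNReal.ofReal_ne_top, ?_⟩
  rw [hchain, ENNReal.toReal_ofReal (setIntegral_nonneg measurableSet_Ioo hφnn)]
  obtain ⟨hnu_int, hnu_le⟩ :=
    setIntegral_nu_mul_sub_rpow_le hC hη hνm hνc hν0 h313a h313b ht' ht't htT
  -- pointwise splitting `√t ≤ √(t-s) + √s`
  have hpt : ∀ s ∈ Ioo t' t, Real.sqrt t * φ s ≤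
      c * (ν s * (s - t') ^ (-(1 / 2 : ℝ))) +
        c * K₀ * ((t - s) ^ (-(1 / 2 : ℝ)) * (s - t') ^ (-(1 / 2 : ℝ))) := by
    intro s hs
    have hs0 : 0 < s := ht'.trans hs.1
    have hts : 0 < t - s := sub_pos.2 hs.2
    obtain ⟨hν0s, -, -⟩ := nu_le_of_sqrt_mul_le hν0 h313a ht' ⟨hs.1.le, hs.2.le.trans htT⟩
    have hsq := sqrt_le_sqrt_sub_add_sqrt hs0.le hs.2.le
    have hφs : 0 ≤ φ s := hφnn s hs
    have hA : Real.sqrt (t - s) * φ s = c * (ν s * (s - t') ^ (-(1 / 2 : ℝ))) := by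
      have h1 := sqrt_mul_rpow_neg_half hts
      simp only [hφ]
      calc Real.sqrt (t - s) * (c * (t - s) ^ (-(1 / 2 : ℝ)) * ν s * (s - t') ^ (-(1 / 2 : ℝ)))
          = c * (Real.sqrt (t - s) * (t - s) ^ (-(1 / 2 : ℝ))) *
              (ν s * (s - t') ^ (-(1 / 2 : ℝ))) := by ring
        _ = c * (ν s * (s - t') ^ (-(1 / 2 : ℝ))) := by rw [h1, mul_one]
    have hB : Real.sqrt s * φ s ≤
        c * K₀ * ((t - s) ^ (-(1 / 2 : ℝ)) * (s - t') ^ (-(1 / 2 : ℝ))) := by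
      have h313 := h313a s ⟨hs0, hs.2.le.trans htT⟩
      have hprod : 0 ≤ (t - s) ^ (-(1 / 2 : ℝ)) * (s - t') ^ (-(1 / 2 : ℝ)) :=
        mul_nonneg (Real.rpow_nonneg hts.le _) (Real.rpow_nonneg (sub_pos.2 hs.1).le _)
      simp only [hφ]
      calc Real.sqrt s * (c * (t - s) ^ (-(1 / 2 : ℝ)) * ν s * (s - t') ^ (-(1 / 2 : ℝ)))
          = c * (Real.sqrt s * ν s) * ((t - s) ^ (-(1 / 2 : ℝ)) * (s - t') ^ (-(1 / 2 : ℝ))) := by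
            ring
        _ ≤ c * K₀ * ((t - s) ^ (-(1 / 2 : ℝ)) * (s - t') ^ (-(1 / 2 : ℝ))) :=
            mul_le_mul_of_nonneg_right (mul_le_mul_of_nonneg_left h313 hc) hprod
    calc Real.sqrt t * φ s ≤ (Real.sqrt (t - s) + Real.sqrt s) * φ s :=
          mul_le_mul_of_nonneg_right hsq hφs
      _ = Real.sqrt (t - s) * φ s + Real.sqrt s * φ s := by ring
      _ ≤ _ := by rw [hA]; exact add_le_add le_rfl hB
  have hR1 : IntegrableOn (fun s => c * (ν s * (s - t') ^ (-(1 / 2 : ℝ)))) (Ioo t' t) :=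
    hnu_int.const_mul c
  have hR2 : IntegrableOn (fun s => c * K₀ * ((t - s) ^ (-(1 / 2 : ℝ)) *
      (s - t') ^ (-(1 / 2 : ℝ)))) (Ioo t' t) := hab_int.const_mul _
  calc Real.sqrt t * ∫ s in Ioo t' t, φ s = ∫ s in Ioo t' t, Real.sqrt t * φ s :=
        (integral_const_mul _ _).symm
    _ ≤ ∫ s in Ioo t' t, (c * (ν s * (s - t') ^ (-(1 / 2 : ℝ))) +
          c * K₀ * ((t - s) ^ (-(1 / 2 : ℝ)) * (s - t') ^ (-(1 / 2 : ℝ)))) :=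
        setIntegral_mono_on (hφint.const_mul _) (hR1.add hR2) measurableSet_Ioo hpt
    _ = (c * ∫ s in Ioo t' t, ν s * (s - t') ^ (-(1 / 2 : ℝ))) +
          c * K₀ * ∫ s in Ioo t' t, (t - s) ^ (-(1 / 2 : ℝ)) * (s - t') ^ (-(1 / 2 : ℝ)) := by
        rw [integral_add hR1 hR2, integral_const_mul, integral_const_mul]
    _ ≤ c * (2 * K₀ + Real.sqrt 2 * C * (1 + η * Real.log (t / t'))) + c * K₀ * 8 := by
        gcongr
    _ = c * (10 * K₀ + Real.sqrt 2 * C * (1 + η * Real.log (t / t'))) := by ring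

/-- **The kernel after the weight `t^{1/2}`.** For a profile `q` vanishing before `t'` and bounded
on `(t', T]`, `√t · (K q)(t) ≤ ∫_{t'}^t (c s^{-1/2}ν(s) + (t-s)^{-1/2} cν(s)) (√s q(s)) ds`, because
`√t ≤ √(t-s) + √s`: the printed kernel `(s^{-1/2} + (t-s)^{-1/2})‖v(s)‖_{L^∞}` for `h = t^{1/2}(…)`.
[cite: CoiculescuPalasek2025, proof of Prop. 4.2 (the inequality for h(t))] -/
theorem sqrt_mul_volterraK_toReal_le (hc : 0 ≤ c) (hνm : Measurable ν)
    (hν0 : ∀ s ∈ Ioc 0 T, 0 ≤ ν s) (h313a : ∀ s ∈ Ioc 0 T, Real.sqrt s * ν s ≤ K₀)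
    {q : ℝ → ℝ≥0∞} (hqm : Measurable q) {t' : ℝ} (ht' : 0 < t') (hq0 : ∀ s ≤ t', q s = 0)
    {B : ℝ} (hB : 0 ≤ B) (hqB : ∀ s ∈ Ioc t' T, q s ≤ ENNReal.ofReal B)
    {t : ℝ} (ht't : t' ≤ t) (htT : t ≤ T) :
    volterraK c ν q t ≠ ∞ ∧
      Real.sqrt t * (volterraK c ν q t).toReal ≤
        ∫ s in t'..t, (c * s ^ (-(1 / 2 : ℝ)) * ν s + (t - s) ^ (-(1 / 2 : ℝ)) * (c * ν s)) *
          (Real.sqrt s * (q s).toReal) := by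
  have hqfin : ∀ s ∈ Ioc t' T, q s ≠ ∞ := fun s hs =>
    ne_top_of_le_ne_top ENNReal.ofReal_ne_top (hqB s hs)
  have hqR : ∀ s ∈ Ioc t' T, (q s).toReal ≤ B := fun s hs =>
    ENNReal.toReal_le_of_le_ofReal hB (hqB s hs)
  set ρ : ℝ → ℝ := fun s => c * (t - s) ^ (-(1 / 2 : ℝ)) * ν s * (q s).toReal with hρ
  have hV : volterraK c ν q t = ∫⁻ s in Ioo t' t, ENNReal.ofReal (ρ s) := by
    rw [volterraK_eq_setLIntegral_Ioo ht'.le hq0]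
    refine setLIntegral_congr_fun measurableSet_Ioo fun s hs => ?_
    rw [kern, ← ENNReal.ofReal_toReal (hqfin s ⟨hs.1, hs.2.le.trans htT⟩),
      ← ENNReal.ofReal_mul' ENNReal.toReal_nonneg]
  have hρ_eq : ∀ s, ρ s = (c * ν s * (q s).toReal) * (t - s) ^ (-(1 / 2 : ℝ)) :=
    fun s => by simp only [hρ]; ring
  have hmeas1 : Measurable fun s => c * ν s * (q s).toReal :=
    (measurable_const.mul hνm).mul hqm.ennreal_toReal
  have hρint : IntegrableOn ρ (Ioo t' t) := by
    have h : IntegrableOn (fun s => (c * ν s * (q s).toReal) * (t - s) ^ (-(1 / 2 : ℝ)))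
        (Ioo t' t) := by
      refine Integrable.bdd_mul (c := c * (K₀ * t' ^ (-(1 / 2 : ℝ))) * B)
        (integrableOn_sub_rpow_Ioo (by norm_num)) hmeas1.aestronglyMeasurable ?_
      refine (ae_restrict_iff' measurableSet_Ioo).2 (Eventually.of_forall fun s hs => ?_)
      obtain ⟨h0, -, h2⟩ := nu_le_of_sqrt_mul_le hν0 h313a ht' ⟨hs.1.le, hs.2.le.trans htT⟩
      rw [Real.norm_eq_abs, abs_of_nonneg (mul_nonneg (mul_nonneg hc h0) ENNReal.toReal_nonneg)]
      exact mul_le_mul (mul_le_mul_of_nonneg_left h2 hc) (hqR s ⟨hs.1, hs.2.le.trans htT⟩)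
        ENNReal.toReal_nonneg (mul_nonneg hc (mul_nonneg
          (le_trans (mul_nonneg (Real.sqrt_nonneg _) h0) (h313a s ⟨ht'.trans hs.1, hs.2.le.trans htT⟩))
          (Real.rpow_nonneg ht'.le _)))
    exact h.congr_fun (fun s _ => (hρ_eq s).symm) measurableSet_Ioo
  have hρnn : ∀ s ∈ Ioo t' t, 0 ≤ ρ s := by
    intro s hs
    obtain ⟨h0, -, -⟩ := nu_le_of_sqrt_mul_le hν0 h313a ht' ⟨hs.1.le, hs.2.le.trans htT⟩
    simp only [hρ]
    exact mul_nonneg (mul_nonneg (mul_nonneg hc (Real.rpow_nonneg (sub_pos.2 hs.2).le _)) h0)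
      ENNReal.toReal_nonneg
  have hVr : volterraK c ν q t = ENNReal.ofReal (∫ s in Ioo t' t, ρ s) := by
    rw [hV, ofReal_integral_eq_lintegral_ofReal hρint
      ((ae_restrict_iff' measurableSet_Ioo).2 (Eventually.of_forall hρnn))]
  refine ⟨by rw [hVr]; exact ENNReal.ofReal_ne_top, ?_⟩
  rw [hVr, ENNReal.toReal_ofReal (setIntegral_nonneg measurableSet_Ioo hρnn)]
  -- the right-hand integrand and its integrability
  set R : ℝ → ℝ := fun s => (c * s ^ (-(1 / 2 : ℝ)) * ν s + (t - s) ^ (-(1 / 2 : ℝ)) * (c * ν s)) *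
    (Real.sqrt s * (q s).toReal) with hR
  have hR_eq : ∀ s ∈ Ioo t' t, R s = c * ν s * (q s).toReal + Real.sqrt s * ρ s := by
    intro s hs
    have hs0 : 0 < s := ht'.trans hs.1
    have h1 : s ^ (-(1 / 2 : ℝ)) * Real.sqrt s = 1 := by
      rw [mul_comm]; exact sqrt_mul_rpow_neg_half hs0
    simp only [hR, hρ]
    calc (c * s ^ (-(1 / 2 : ℝ)) * ν s + (t - s) ^ (-(1 / 2 : ℝ)) * (c * ν s)) *
          (Real.sqrt s * (q s).toReal)
        = c * ν s * (q s).toReal * (s ^ (-(1 / 2 : ℝ)) * Real.sqrt s) +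
            Real.sqrt s * (c * (t - s) ^ (-(1 / 2 : ℝ)) * ν s * (q s).toReal) := by ring
      _ = _ := by rw [h1, mul_one]
  have hRint : IntegrableOn R (Ioo t' t) := by
    have h1 : IntegrableOn (fun s => c * ν s * (q s).toReal) (Ioo t' t) := by
      have h := Integrable.bdd_mul (c := c * (K₀ * t' ^ (-(1 / 2 : ℝ))) * B)
        (integrableOn_const (μ := volume) (s := Ioo t' t) (C := (1 : ℝ))
          (measure_Ioo_lt_top.ne)) hmeas1.aestronglyMeasurable ?_
      · have h' : Integrable (fun x => c * ν x * (q x).toReal) (volume.restrict (Ioo t' t)) := by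
          simpa using h
        exact h'
      refine (ae_restrict_iff' measurableSet_Ioo).2 (Eventually.of_forall fun s hs => ?_)
      obtain ⟨h0, -, h2⟩ := nu_le_of_sqrt_mul_le hν0 h313a ht' ⟨hs.1.le, hs.2.le.trans htT⟩
      rw [Real.norm_eq_abs, abs_of_nonneg (mul_nonneg (mul_nonneg hc h0) ENNReal.toReal_nonneg)]
      exact mul_le_mul (mul_le_mul_of_nonneg_left h2 hc) (hqR s ⟨hs.1, hs.2.le.trans htT⟩)
        ENNReal.toReal_nonneg (mul_nonneg hc (mul_nonneg
          (le_trans (mul_nonneg (Real.sqrt_nonneg _) h0) (h313a s ⟨ht'.trans hs.1, hs.2.le.trans htT⟩))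
          (Real.rpow_nonneg ht'.le _)))
    have h2 : IntegrableOn (fun s => Real.sqrt s * ρ s) (Ioo t' t) := by
      refine Integrable.bdd_mul (c := Real.sqrt T) hρint
        (Real.continuous_sqrt.measurable.aestronglyMeasurable) ?_
      refine (ae_restrict_iff' measurableSet_Ioo).2 (Eventually.of_forall fun s hs => ?_)
      rw [Real.norm_eq_abs, abs_of_nonneg (Real.sqrt_nonneg _)]
      exact Real.sqrt_le_sqrt (hs.2.le.trans htT)
    exact (h1.add h2).congr_fun (fun s hs => (hR_eq s hs).symm) measurableSet_Ioo
  have hpt : ∀ s ∈ Ioo t' t, Real.sqrt t * ρ s ≤ R s := by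
    intro s hs
    have hs0 : 0 < s := ht'.trans hs.1
    have hts : 0 < t - s := sub_pos.2 hs.2
    obtain ⟨h0, -, -⟩ := nu_le_of_sqrt_mul_le hν0 h313a ht' ⟨hs.1.le, hs.2.le.trans htT⟩
    have hsq := sqrt_le_sqrt_sub_add_sqrt hs0.le hs.2.le
    have hA : Real.sqrt (t - s) * ρ s = c * ν s * (q s).toReal := by
      have h1 := sqrt_mul_rpow_neg_half hts
      simp only [hρ]
      calc Real.sqrt (t - s) * (c * (t - s) ^ (-(1 / 2 : ℝ)) * ν s * (q s).toReal)
          = (Real.sqrt (t - s) * (t - s) ^ (-(1 / 2 : ℝ))) * (c * ν s * (q s).toReal) := by ring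
        _ = _ := by rw [h1, one_mul]
    rw [hR_eq s hs, ← hA]
    calc Real.sqrt t * ρ s ≤ (Real.sqrt (t - s) + Real.sqrt s) * ρ s :=
          mul_le_mul_of_nonneg_right hsq (hρnn s hs)
      _ = Real.sqrt (t - s) * ρ s + Real.sqrt s * ρ s := by ring
  calc Real.sqrt t * ∫ s in Ioo t' t, ρ s = ∫ s in Ioo t' t, Real.sqrt t * ρ s :=
        (integral_const_mul _ _).symm
    _ ≤ ∫ s in Ioo t' t, R s :=
        setIntegral_mono_on (hρint.const_mul _) hRint measurableSet_Ioo hpt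
    _ = ∫ s in t'..t, R s := by
        rw [intervalIntegral.integral_of_le ht't, integral_Ioc_eq_integral_Ioo]

/-- Crude finiteness of the entry-time chains on `(t', T]` (qualitative input of the Grönwall
argument: `K f_{t'} ≤ 8cK₀(t')^{-1/2}`, and `K` maps constants to constants times `2cK₀(t')^{-1/2}√T`).
[folklore] -/
theorem exists_chain_succ_le_ofReal (hc : 0 ≤ c) (hK : 0 ≤ K₀)
    (hν0 : ∀ s ∈ Ioc 0 T, 0 ≤ ν s)
    (h313a : ∀ s ∈ Ioc 0 T, Real.sqrt s * ν s ≤ K₀) {t' : ℝ} (ht' : 0 < t') :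
    ∀ m : ℕ, ∃ B : ℝ, 0 ≤ B ∧ ∀ s ∈ Ioc t' T, chain c ν (m + 1) t' s ≤ ENNReal.ofReal B := by
  have hkern : ∀ s ∈ Ioc t' T, ∀ u ∈ Ioo t' s,
      kern c ν s u ≤ ENNReal.ofReal (c * (K₀ * t' ^ (-(1 / 2 : ℝ))) * (s - u) ^ (-(1 / 2 : ℝ))) := by
    intro s hs u hu
    obtain ⟨h0, -, h2⟩ := nu_le_of_sqrt_mul_le hν0 h313a ht' ⟨hu.1.le, hu.2.le.trans hs.2⟩
    rw [kern]
    refine ENNReal.ofReal_le_ofReal ?_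
    calc c * (s - u) ^ (-(1 / 2 : ℝ)) * ν u = c * ν u * (s - u) ^ (-(1 / 2 : ℝ)) := by ring
      _ ≤ c * (K₀ * t' ^ (-(1 / 2 : ℝ))) * (s - u) ^ (-(1 / 2 : ℝ)) :=
          mul_le_mul_of_nonneg_right (mul_le_mul_of_nonneg_left h2 hc)
            (Real.rpow_nonneg (sub_pos.2 hu.2).le _)
  set L : ℝ := c * (K₀ * t' ^ (-(1 / 2 : ℝ))) with hL
  have hL0 : 0 ≤ L := mul_nonneg hc (mul_nonneg hK (Real.rpow_nonneg ht'.le _))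
  intro m
  induction m with
  | zero =>
    refine ⟨L * 8, by positivity, fun s hs => ?_⟩
    obtain ⟨hint, hle⟩ := setIntegral_sub_rpow_mul_sub_rpow_le hs.1
    have hnn : ∀ u ∈ Ioo t' s, 0 ≤ (s - u) ^ (-(1 / 2 : ℝ)) * (u - t') ^ (-(1 / 2 : ℝ)) :=
      fun u hu => mul_nonneg (Real.rpow_nonneg (sub_pos.2 hu.2).le _)
        (Real.rpow_nonneg (sub_pos.2 hu.1).le _)
    calc chain c ν (0 + 1) t' s
        = ∫⁻ u in Ioo t' s, kern c ν s u * chain c ν 0 t' u := by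
          rw [zero_add, chain_succ, volterraK_eq_setLIntegral_Ioo ht'.le
            (fun u hu => chain_eq_zero_of_le 0 hu)]
      _ ≤ ∫⁻ u in Ioo t' s, ENNReal.ofReal L *
            ENNReal.ofReal ((s - u) ^ (-(1 / 2 : ℝ)) * (u - t') ^ (-(1 / 2 : ℝ))) := by
          refine setLIntegral_mono' measurableSet_Ioo fun u hu => ?_
          rw [chain_zero, if_pos hu.1, ENNReal.ofReal_mul (Real.rpow_nonneg (sub_pos.2 hu.2).le _),
            ← mul_assoc, ← ENNReal.ofReal_mul hL0]
          exact mul_le_mul' (hkern s hs u hu) le_rfl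
      _ = ENNReal.ofReal L * ENNReal.ofReal (∫ u in Ioo t' s,
            (s - u) ^ (-(1 / 2 : ℝ)) * (u - t') ^ (-(1 / 2 : ℝ))) := by
          rw [lintegral_const_mul' _ _ ENNReal.ofReal_ne_top, ofReal_integral_eq_lintegral_ofReal
            hint ((ae_restrict_iff' measurableSet_Ioo).2 (Eventually.of_forall hnn))]
      _ ≤ ENNReal.ofReal L * ENNReal.ofReal 8 := mul_le_mul' le_rfl (ENNReal.ofReal_le_ofReal hle)
      _ = ENNReal.ofReal (L * 8) := by rw [← ENNReal.ofReal_mul hL0]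
  | succ m ih =>
    obtain ⟨B, hB0, hB⟩ := ih
    refine ⟨L * B * (2 * Real.sqrt T), by positivity, fun s hs => ?_⟩
    have hs0 : 0 < s := ht'.trans hs.1
    calc chain c ν (m + 1 + 1) t' s
        = ∫⁻ u in Ioo t' s, kern c ν s u * chain c ν (m + 1) t' u := by
          rw [chain_succ, volterraK_eq_setLIntegral_Ioo ht'.le
            (fun u hu => chain_eq_zero_of_le (m + 1) hu)]
      _ ≤ ∫⁻ u in Ioo t' s, ENNReal.ofReal (L * B) * ENNReal.ofReal ((s - u) ^ (-(1 / 2 : ℝ))) := by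
          refine setLIntegral_mono' measurableSet_Ioo fun u hu => ?_
          calc kern c ν s u * chain c ν (m + 1) t' u
              ≤ ENNReal.ofReal (L * (s - u) ^ (-(1 / 2 : ℝ))) * ENNReal.ofReal B :=
                mul_le_mul' (hkern s hs u hu) (hB u ⟨hu.1, hu.2.le.trans hs.2⟩)
            _ = ENNReal.ofReal (L * B) * ENNReal.ofReal ((s - u) ^ (-(1 / 2 : ℝ))) := by
                rw [← ENNReal.ofReal_mul (mul_nonneg hL0 (Real.rpow_nonneg (sub_pos.2 hu.2).le _)),
                  ← ENNReal.ofReal_mul (mul_nonneg hL0 hB0)]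
                ring_nf
      _ = ENNReal.ofReal (L * B) * ENNReal.ofReal ((s - t') ^ (1 - 1 / 2 : ℝ) / (1 - 1 / 2)) := by
          rw [lintegral_const_mul' _ _ ENNReal.ofReal_ne_top, ← setIntegral_Ioo_sub_rpow_neg hs.1.le
            (by norm_num : (1 / 2 : ℝ) < 1), ofReal_integral_eq_lintegral_ofReal
            (integrableOn_sub_rpow_Ioo (by norm_num))
            ((ae_restrict_iff' measurableSet_Ioo).2 (Eventually.of_forall fun u hu =>
              Real.rpow_nonneg (sub_pos.2 hu.2).le _))]
      _ ≤ ENNReal.ofReal (L * B) * ENNReal.ofReal (2 * Real.sqrt T) := by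
          refine mul_le_mul' le_rfl (ENNReal.ofReal_le_ofReal ?_)
          have h1 : (s - t') ^ (1 - 1 / 2 : ℝ) ≤ Real.sqrt T := by
            rw [Real.sqrt_eq_rpow, show (1 - 1 / 2 : ℝ) = 1 / 2 by norm_num]
            exact Real.rpow_le_rpow (sub_pos.2 hs.1).le (by linarith [hs.2]) (by norm_num)
          have h2 : (s - t') ^ (1 - 1 / 2 : ℝ) / (1 - 1 / 2) = 2 * (s - t') ^ (1 - 1 / 2 : ℝ) := by
            ring
          rw [h2]
          exact mul_le_mul_of_nonneg_left h1 (by norm_num)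
      _ = ENNReal.ofReal (L * B * (2 * Real.sqrt T)) := by
          rw [← ENNReal.ofReal_mul (mul_nonneg hL0 hB0)]

/-- **The resolvent per entry time (the Grönwall step).** For `0 < t' < t ≤ T`,

  `Σ_{1 ≤ n ≤ N} (Kⁿ f_{t'})(t) ≤ Λ t^{-1/2} (t/t')^{ε}`,

`Λ = 3c(10K₀ + √2 C) e^{3θ}`, `θ = c(1 + 2731c²K₀)C`, `ε = (3θ + 1)η`, uniformly in `N`: the printed
`h(t) ≲ (t')^{-1+α}‖a‖_Y exp(O(1 + (log A)⁻¹ log(t/t')))`, "The exponential factor becomes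
`O((t/t')^{O(1/log A)})`", obtained from the tree's `fractional_gronwall` (Lemma B.3, `p = 3`) applied
to `h = t^{1/2} q_N`, `q_N = Σ_{1≤n≤N} Kⁿ f_{t'}`, with `g₁ = c s^{-1/2}ν`, `g₂ = cν`,
`‖s^{1/2} g₂‖_∞ ≤ cK₀`, datum `a(t) = c(10K₀ + √2 C(1 + η log(t/t')))`
(`sqrt_mul_chain_one_toReal_le`) and kernel `sqrt_mul_volterraK_toReal_le`; the exponent
`3∫(g₁ + (8192/3)(cK₀)g₂²) ≤ 3θ(1 + η log(t/t'))` by (3.13b), and `1 + η log x ≤ x^η`.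
[cite: CoiculescuPalasek2025, Prop. 4.2 and its proof; App. B, Lemma B.3] -/
theorem sum_chain_succ_le (hc : 0 < c) (hK₀ : 0 < K₀) (hC : 0 ≤ C) (hη : 0 ≤ η)
    (hνm : Measurable ν) (hνc : ContinuousOn ν (Ioc 0 T)) (hν0 : ∀ s ∈ Ioc 0 T, 0 ≤ ν s)
    (h313a : ∀ s ∈ Ioc 0 T, Real.sqrt s * ν s ≤ K₀)
    (h313b : ∀ t₁ t₂ : ℝ, 0 < t₁ → t₁ ≤ t₂ → t₂ ≤ T →
      ∫ s in t₁..t₂, (ν s ^ 2 + s ^ (-(1 / 2 : ℝ)) * ν s) ≤ C * (1 + η * Real.log (t₂ / t₁)))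
    {t' : ℝ} (ht' : 0 < t') (N : ℕ) {t : ℝ} (ht't : t' < t) (htT : t ≤ T) :
    ∑ m ∈ Finset.range N, chain c ν (m + 1) t' t ≤
      ENNReal.ofReal (3 * (c * (10 * K₀ + Real.sqrt 2 * C)) *
        Real.exp (3 * (c * (1 + 2731 * c ^ 2 * K₀) * C)) * t ^ (-(1 / 2 : ℝ)) *
          (t / t') ^ ((3 * (c * (1 + 2731 * c ^ 2 * K₀) * C) + 1) * η)) := by
  have hK : 0 ≤ K₀ := hK₀.le
  have hT : 0 ≤ T := (ht'.trans ht't).le.trans htT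
  have ht0 : 0 < t := ht'.trans ht't
  set θ : ℝ := c * (1 + 2731 * c ^ 2 * K₀) * C with hθ
  have hθ0 : 0 ≤ θ := by positivity
  -- the partial sums and their crude bound
  set q : ℝ → ℝ≥0∞ := fun s => ∑ m ∈ Finset.range N, chain c ν (m + 1) t' s with hq
  have hqm : Measurable q :=
    Finset.measurable_sum _ fun m _ => measurable_chain_right hνm (m + 1) t'
  have hq0 : ∀ s ≤ t', q s = 0 := fun s hs =>
    Finset.sum_eq_zero fun m _ => chain_eq_zero_of_le _ hs
  obtain ⟨B, hB0, hqB⟩ : ∃ B, 0 ≤ B ∧ ∀ s ∈ Ioc t' T, q s ≤ ENNReal.ofReal B := by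
    have hex := exists_chain_succ_le_ofReal hc.le hK hν0 h313a ht' (c := c) (ν := ν)
    choose Bf hBf0 hBf using hex
    refine ⟨∑ m ∈ Finset.range N, Bf m, Finset.sum_nonneg fun m _ => hBf0 m, fun s hs => ?_⟩
    rw [ENNReal.ofReal_sum_of_nonneg (fun m _ => hBf0 m)]
    exact Finset.sum_le_sum fun m _ => hBf m s hs
  -- the recursion `q ≤ K f_{t'} + K q`
  have hqle : ∀ s, q s ≤ chain c ν 1 t' s + volterraK c ν q s := fun s =>
    sum_chain_succ_le_add hνm N t' s
  -- the real-variable data of the Grönwall inequality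
  set f : ℝ → ℝ := fun s => Real.sqrt s * (q s).toReal with hf
  set g₁ : ℝ → ℝ := fun s => c * s ^ (-(1 / 2 : ℝ)) * ν s with hg₁
  set g₂ : ℝ → ℝ := fun s => c * ν s with hg₂
  set a : ℝ → ℝ := fun s => c * (10 * K₀ + Real.sqrt 2 * C * (1 + η * Real.log (s / t'))) with ha
  have hνc' : ContinuousOn ν (Icc t' T) := hνc.mono fun s hs => ⟨ht'.trans_le hs.1, hs.2⟩
  have hfm : AEStronglyMeasurable f (volume.restrict (Ioc t' T)) :=
    (Real.continuous_sqrt.measurable.mul hqm.ennreal_toReal).aestronglyMeasurable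
  have hf0 : ∀ s ∈ Icc t' T, 0 ≤ f s := fun s _ =>
    mul_nonneg (Real.sqrt_nonneg _) ENNReal.toReal_nonneg
  have hfB : ∀ s ∈ Icc t' T, f s ≤ Real.sqrt T * B := by
    intro s hs
    rcases eq_or_lt_of_le hs.1 with h | h
    · have : q s = 0 := hq0 s h.symm.le
      simp only [hf, this, ENNReal.toReal_zero, mul_zero]
      positivity
    · exact mul_le_mul (Real.sqrt_le_sqrt hs.2)
        (ENNReal.toReal_le_of_le_ofReal hB0 (hqB s ⟨h, hs.2⟩)) ENNReal.toReal_nonneg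
        (Real.sqrt_nonneg _)
  have hg₁c : ContinuousOn g₁ (Icc t' T) := by
    refine (continuousOn_const.mul ?_).mul hνc'
    exact ContinuousOn.rpow_const continuousOn_id fun s hs =>
      Or.inl (ne_of_gt (show (0:ℝ) < id s from by simp only [id_eq]; linarith [hs.1]))
  have hg₂c : ContinuousOn g₂ (Icc t' T) := continuousOn_const.mul hνc'
  have hg₁0 : ∀ s ∈ Icc t' T, 0 ≤ g₁ s := fun s hs =>
    mul_nonneg (mul_nonneg hc.le (Real.rpow_nonneg (ht'.le.trans hs.1) _))
      (nu_le_of_sqrt_mul_le hν0 h313a ht' hs).1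
  have hg₂0 : ∀ s ∈ Icc t' T, 0 ≤ g₂ s := fun s hs =>
    mul_nonneg hc.le (nu_le_of_sqrt_mul_le hν0 h313a ht' hs).1
  have hg₂M : ∀ s ∈ Icc t' T, Real.sqrt s * g₂ s ≤ c * K₀ := by
    intro s hs
    have := h313a s ⟨ht'.trans_le hs.1, hs.2⟩
    calc Real.sqrt s * g₂ s = c * (Real.sqrt s * ν s) := by simp only [hg₂]; ring
      _ ≤ c * K₀ := mul_le_mul_of_nonneg_left this hc.le
  have hlog0 : ∀ s ∈ Icc t' T, 0 ≤ Real.log (s / t') := fun s hs =>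
    Real.log_nonneg ((one_le_div ht').2 hs.1)
  have ha0 : ∀ s ∈ Icc t' T, 0 ≤ a s := fun s hs => by
    have := hlog0 s hs
    simp only [ha]
    positivity
  have hamono : MonotoneOn a (Icc t' T) := by
    intro s hs u hu hsu
    have h1 : Real.log (s / t') ≤ Real.log (u / t') :=
      Real.log_le_log (by have := ht'.trans_le hs.1; positivity)
        (div_le_div_of_nonneg_right hsu ht'.le)
    simp only [ha]
    gcongr
  have hle : ∀ s ∈ Icc t' T,
      f s ≤ a s + ∫ u in t'..s, (g₁ u + (s - u) ^ (-(1 / 2 : ℝ)) * g₂ u) * f u := by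
    intro s hs
    rcases eq_or_lt_of_le hs.1 with h | h
    · rw [← h, intervalIntegral.integral_same, add_zero]
      have : q t' = 0 := hq0 t' le_rfl
      simp only [hf, this, ENNReal.toReal_zero, mul_zero]
      exact ha0 t' ⟨le_rfl, h.le.trans hs.2⟩
    · obtain ⟨hfin1, hle1⟩ :=
        sqrt_mul_chain_one_toReal_le hc.le hC hη hνm hνc hν0 h313a h313b ht' h hs.2
      obtain ⟨hfin2, hle2⟩ :=
        sqrt_mul_volterraK_toReal_le hc.le hνm hν0 h313a hqm ht' hq0 hB0 hqB h.le hs.2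
      have h1 : (q s).toReal ≤ (chain c ν 1 t' s).toReal + (volterraK c ν q s).toReal := by
        rw [← ENNReal.toReal_add hfin1 hfin2]
        exact ENNReal.toReal_mono (ENNReal.add_ne_top.2 ⟨hfin1, hfin2⟩) (hqle s)
      calc f s = Real.sqrt s * (q s).toReal := rfl
        _ ≤ Real.sqrt s * (chain c ν 1 t' s).toReal +
              Real.sqrt s * (volterraK c ν q s).toReal := by
            rw [← mul_add]; exact mul_le_mul_of_nonneg_left h1 (Real.sqrt_nonneg _)
        _ ≤ a s + ∫ u in t'..s, (g₁ u + (s - u) ^ (-(1 / 2 : ℝ)) * g₂ u) * f u :=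
            add_le_add hle1 hle2
  have hgr := fractional_gronwall ht'.le (by positivity : 0 < c * K₀) hfm hf0 hfB hg₁c hg₂c
    hg₁0 hg₂0 hg₂M ha0 hamono hle t ⟨ht't.le, htT⟩
  -- the exponent
  have hpos : 0 < t / t' := by positivity
  have hx1 : 1 ≤ t / t' := (one_le_div ht').2 ht't.le
  have hlogt : 0 ≤ Real.log (t / t') := Real.log_nonneg hx1
  have hexp : ∫ u in t'..t, (g₁ u + 8192 / 3 * (c * K₀) * g₂ u ^ 2) ≤
      θ * (1 + η * Real.log (t / t')) := by
    have hcont : ContinuousOn (fun u => ν u ^ 2 + u ^ (-(1 / 2 : ℝ)) * ν u) (Icc t' t) := by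
      have hνc'' : ContinuousOn ν (Icc t' t) := hνc'.mono (Icc_subset_Icc le_rfl htT)
      refine (hνc''.pow 2).add (ContinuousOn.mul ?_ hνc'')
      exact ContinuousOn.rpow_const continuousOn_id fun s hs =>
        Or.inl (ne_of_gt (show (0:ℝ) < id s from by simp only [id_eq]; linarith [hs.1]))
    have hmono : ∫ u in t'..t, (g₁ u + 8192 / 3 * (c * K₀) * g₂ u ^ 2) ≤
        ∫ u in t'..t, (c * (1 + 2731 * c ^ 2 * K₀)) * (ν u ^ 2 + u ^ (-(1 / 2 : ℝ)) * ν u) := by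
      refine intervalIntegral.integral_mono_on ht't.le ?_ ?_ fun u hu => ?_
      · exact ((hg₁c.mono (Icc_subset_Icc le_rfl htT)).add
          (continuousOn_const.mul ((hg₂c.mono (Icc_subset_Icc le_rfl htT)).pow 2)))
          |>.intervalIntegrable_of_Icc ht't.le
      · exact (hcont.intervalIntegrable_of_Icc ht't.le).const_mul _
      · obtain ⟨hν0u, -, -⟩ := nu_le_of_sqrt_mul_le hν0 h313a ht' ⟨hu.1, hu.2.trans htT⟩
        have hr : 0 ≤ u ^ (-(1 / 2 : ℝ)) := Real.rpow_nonneg (ht'.le.trans hu.1) _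
        simp only [hg₁, hg₂]
        have h1 : 0 ≤ u ^ (-(1 / 2 : ℝ)) * ν u := mul_nonneg hr hν0u
        have h2 : 0 ≤ ν u ^ 2 := sq_nonneg _
        nlinarith [mul_nonneg (mul_nonneg hc.le (sq_nonneg c)) hK, mul_nonneg hc.le h1,
          mul_nonneg (mul_nonneg (mul_nonneg hc.le (sq_nonneg c)) hK) h2,
          mul_nonneg (mul_nonneg (mul_nonneg hc.le (sq_nonneg c)) hK) h1, mul_nonneg hc.le h2]
    refine hmono.trans ?_
    rw [intervalIntegral.integral_const_mul]
    calc c * (1 + 2731 * c ^ 2 * K₀) * ∫ u in t'..t, (ν u ^ 2 + u ^ (-(1 / 2 : ℝ)) * ν u)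
        ≤ c * (1 + 2731 * c ^ 2 * K₀) * (C * (1 + η * Real.log (t / t'))) :=
          mul_le_mul_of_nonneg_left (h313b t' t ht' ht't.le htT) (by positivity)
      _ = θ * (1 + η * Real.log (t / t')) := by simp only [hθ]; ring
  -- `1 + η log x ≤ x^η`
  have h1η : 1 + η * Real.log (t / t') ≤ (t / t') ^ η := by
    rw [Real.rpow_def_of_pos hpos]
    have := Real.add_one_le_exp (Real.log (t / t') * η)
    linarith [mul_comm η (Real.log (t / t'))]
  have hat : a t ≤ c * (10 * K₀ + Real.sqrt 2 * C) * (t / t') ^ η := by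
    have h1 : 1 ≤ 1 + η * Real.log (t / t') := le_add_of_nonneg_right (mul_nonneg hη hlogt)
    calc a t = c * (10 * K₀ + Real.sqrt 2 * C * (1 + η * Real.log (t / t'))) := rfl
      _ ≤ c * (10 * K₀ * (1 + η * Real.log (t / t')) +
            Real.sqrt 2 * C * (1 + η * Real.log (t / t'))) := by
          refine mul_le_mul_of_nonneg_left (add_le_add ?_ le_rfl) hc.le
          exact le_mul_of_one_le_right (by positivity) h1
      _ = c * (10 * K₀ + Real.sqrt 2 * C) * (1 + η * Real.log (t / t')) := by ring
      _ ≤ c * (10 * K₀ + Real.sqrt 2 * C) * (t / t') ^ η :=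
          mul_le_mul_of_nonneg_left h1η (by positivity)
  have hexp2 : Real.exp (3 * ∫ u in t'..t, (g₁ u + 8192 / 3 * (c * K₀) * g₂ u ^ 2)) ≤
      Real.exp (3 * θ) * (t / t') ^ (3 * θ * η) := by
    calc Real.exp (3 * ∫ u in t'..t, (g₁ u + 8192 / 3 * (c * K₀) * g₂ u ^ 2))
        ≤ Real.exp (3 * (θ * (1 + η * Real.log (t / t')))) :=
          Real.exp_le_exp.2 (by linarith [hexp])
      _ = Real.exp (3 * θ) * Real.exp (Real.log (t / t') * (3 * θ * η)) := by
          rw [← Real.exp_add]; ring_nf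
      _ = Real.exp (3 * θ) * (t / t') ^ (3 * θ * η) := by rw [Real.rpow_def_of_pos hpos]
  have hft : f t ≤ 3 * (c * (10 * K₀ + Real.sqrt 2 * C)) * Real.exp (3 * θ) *
      (t / t') ^ ((3 * θ + 1) * η) := by
    have hprod : (t / t') ^ η * (t / t') ^ (3 * θ * η) = (t / t') ^ ((3 * θ + 1) * η) := by
      rw [← Real.rpow_add hpos]; ring_nf
    calc f t ≤ 3 * a t * Real.exp (3 * ∫ u in t'..t, (g₁ u + 8192 / 3 * (c * K₀) * g₂ u ^ 2)) :=
          hgr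
      _ ≤ 3 * (c * (10 * K₀ + Real.sqrt 2 * C) * (t / t') ^ η) *
            (Real.exp (3 * θ) * (t / t') ^ (3 * θ * η)) := by
          gcongr
      _ = 3 * (c * (10 * K₀ + Real.sqrt 2 * C)) * Real.exp (3 * θ) *
            ((t / t') ^ η * (t / t') ^ (3 * θ * η)) := by ring
      _ = _ := by rw [hprod]
  -- back to `q t`
  have hqfin : q t ≠ ∞ := ne_top_of_le_ne_top ENNReal.ofReal_ne_top (hqB t ⟨ht't, htT⟩)
  have hsqt : 0 < Real.sqrt t := Real.sqrt_pos.2 ht0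
  have hqt : (q t).toReal = f t * t ^ (-(1 / 2 : ℝ)) := by
    have h1 := sqrt_mul_rpow_neg_half ht0
    calc (q t).toReal = (Real.sqrt t * t ^ (-(1 / 2 : ℝ))) * (q t).toReal := by rw [h1, one_mul]
      _ = f t * t ^ (-(1 / 2 : ℝ)) := by simp only [hf]; ring
  change q t ≤ _
  rw [← ENNReal.ofReal_toReal hqfin, hqt]
  refine ENNReal.ofReal_le_ofReal ?_
  calc f t * t ^ (-(1 / 2 : ℝ))
      ≤ (3 * (c * (10 * K₀ + Real.sqrt 2 * C)) * Real.exp (3 * θ) * (t / t') ^ ((3 * θ + 1) * η)) *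
          t ^ (-(1 / 2 : ℝ)) := mul_le_mul_of_nonneg_right hft (Real.rpow_nonneg ht0.le _)
    _ = _ := by ring

/-- **Boundedness of the resolvent of the lacunary Volterra kernel on power profiles**
(Prop. 4.2 of Coiculescu–Palasek at the level of sup norms, in the form consumed by the fixed point
argument of Prop. 4.3). Let `c > 0`, `K₀ > 0`, `C ≥ 0`, `η ≥ 0`, and let `ν ≥ 0` be measurable and
continuous on `(0, T]` with `√s ν(s) ≤ K₀` ((3.13a), `m = 0`) and
`∫_{t₁}^{t₂} (ν² + s^{-1/2}ν) ≤ C(1 + η log(t₂/t₁))` for `0 < t₁ ≤ t₂ ≤ T` ((3.13b)). Let `0 < a ≤ 1`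
and suppose the slope is small: `(3θ + 1)η ≤ a/2`, `θ = c(1 + 2731c²K₀)C`. Then for all `N` and
`t ∈ (0, T]`,

  `Σ_{n<N} (Kⁿ p_a)(t) ≤ (2/a + 4 + 2Λ/a) t^{a - 1/2}`,  `Λ = 3c(10K₀ + √2 C)e^{3θ}`,

`p_a(t) = t^{a-1/2}`, `K` the Volterra operator with kernel `c(t-s)^{-1/2}ν(s)`. (Superposition
`powProfile_le_superpos`/`iterate_volterraK_superpos`, the per-entry-time bound
`sum_chain_succ_le`, and the Abel–Beta bounds of the tree.)
[cite: CoiculescuPalasek2025, Prop. 4.2 with the proof of Prop. 4.3 (‖T(w)(t)‖_{L^∞} ≲ t^{-1/2+ε}∫₀ᵗ(t')^{-1+α-ε}dt' ≲ t^{-1/2+α})] -/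
theorem sum_iterate_volterraK_powProfile_le (hc : 0 < c) (hK₀ : 0 < K₀) (hC : 0 ≤ C) (hη : 0 ≤ η)
    (hνm : Measurable ν) (hνc : ContinuousOn ν (Ioc 0 T)) (hν0 : ∀ s ∈ Ioc 0 T, 0 ≤ ν s)
    (h313a : ∀ s ∈ Ioc 0 T, Real.sqrt s * ν s ≤ K₀)
    (h313b : ∀ t₁ t₂ : ℝ, 0 < t₁ → t₁ ≤ t₂ → t₂ ≤ T →
      ∫ s in t₁..t₂, (ν s ^ 2 + s ^ (-(1 / 2 : ℝ)) * ν s) ≤ C * (1 + η * Real.log (t₂ / t₁)))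
    {a : ℝ} (ha : 0 < a) (ha1 : a ≤ 1)
    (hε : ((3 * (c * (1 + 2731 * c ^ 2 * K₀) * C) + 1) * η) ≤ a / 2)
    (N : ℕ) {t : ℝ} (ht : t ∈ Ioc 0 T) :
    ∑ n ∈ Finset.range N, (volterraK c ν)^[n] (powProfile a) t ≤
      ENNReal.ofReal ((2 / a + 4 + 2 * (3 * (c * (10 * K₀ + Real.sqrt 2 * C)) *
        Real.exp (3 * (c * (1 + 2731 * c ^ 2 * K₀) * C))) / a) * t ^ (a - 1 / 2)) := by
  set θ : ℝ := c * (1 + 2731 * c ^ 2 * K₀) * C with hθ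
  set Λ : ℝ := 3 * (c * (10 * K₀ + Real.sqrt 2 * C)) * Real.exp (3 * θ) with hΛ
  set ε : ℝ := (3 * θ + 1) * η with hεdef
  have hΛ0 : 0 ≤ Λ := by positivity
  have hε0 : 0 ≤ ε := by positivity
  have hεa : ε < a := by linarith
  have ht0 : 0 < t := ht.1
  -- superposition
  set w : ℝ → ℝ≥0∞ := fun t' => ENNReal.ofReal (t' ^ (a - 1)) with hw
  have hwm : Measurable w := (measurable_id.pow_const _).ennreal_ofReal
  have h1 : ∀ n, (volterraK c ν)^[n] (powProfile a) t ≤ superpos c ν n w t := by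
    intro n
    rw [← iterate_volterraK_superpos hνm hwm n]
    exact iterate_volterraK_mono (fun s hs => powProfile_le_superpos ha1 hs) n t ht0
  have h2 : ∑ n ∈ Finset.range N, superpos c ν n w t =
      ∫⁻ t' in Ioo 0 t, (∑ n ∈ Finset.range N, chain c ν n t' t) * w t' := by
    simp only [superpos, Finset.sum_mul]
    rw [lintegral_finsetSum']
    exact fun n _ => ((measurable_chain_left hνm n t).mul hwm).aemeasurable
  -- the per-entry-time bound
  have h3 : ∀ t' ∈ Ioo 0 t, ∑ n ∈ Finset.range N, chain c ν n t' t ≤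
      ENNReal.ofReal ((t - t') ^ (-(1 / 2 : ℝ))) +
        ENNReal.ofReal (Λ * t ^ (-(1 / 2 : ℝ)) * (t / t') ^ ε) := by
    intro t' ht'
    cases N with
    | zero => simp
    | succ M =>
      rw [Finset.sum_range_succ', chain_zero, if_pos ht'.2, add_comm]
      exact add_le_add le_rfl
        (sum_chain_succ_le hc hK₀ hC hη hνm hνc hν0 h313a h313b ht'.1 M ht'.2 ht.2)
  -- integrate
  have hI1 : ∫⁻ t' in Ioo 0 t, ENNReal.ofReal ((t - t') ^ (-(1 / 2 : ℝ))) * w t' ≤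
      ENNReal.ofReal ((2 / a + 4) * t ^ (a - 1 / 2)) := by
    obtain ⟨hint, hle⟩ := setIntegral_abel_rpow_rpow_le (a := 1 / 2) (b := 1 - a) (t := t)
      (by norm_num) (by norm_num) (by linarith) (by linarith) ht0
    have heq : ∀ t' ∈ Ioo 0 t, ENNReal.ofReal ((t - t') ^ (-(1 / 2 : ℝ))) * w t' =
        ENNReal.ofReal ((t - t') ^ (-(1 / 2 : ℝ)) * t' ^ (-(1 - a))) := by
      intro t' ht'
      rw [hw, ← ENNReal.ofReal_mul (Real.rpow_nonneg (sub_pos.2 ht'.2).le _)]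
      congr 2
      ring_nf
    rw [setLIntegral_congr_fun measurableSet_Ioo heq, ← ofReal_integral_eq_lintegral_ofReal hint]
    · refine ENNReal.ofReal_le_ofReal (hle.trans (le_of_eq ?_))
      have e1 : (1 - (1 - a) : ℝ) = a := by ring
      have e2 : (1 - 1 / 2 - (1 - a) : ℝ) = a - 1 / 2 := by ring
      rw [e1, e2]
      norm_num
    · exact (ae_restrict_iff' measurableSet_Ioo).2 (Eventually.of_forall fun t' ht' =>
        mul_nonneg (Real.rpow_nonneg (sub_pos.2 ht'.2).le _) (Real.rpow_nonneg ht'.1.le _))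
  have hI2 : ∫⁻ t' in Ioo 0 t, ENNReal.ofReal (Λ * t ^ (-(1 / 2 : ℝ)) * (t / t') ^ ε) * w t' ≤
      ENNReal.ofReal (2 * Λ / a * t ^ (a - 1 / 2)) := by
    have heq : ∀ t' ∈ Ioo 0 t, ENNReal.ofReal (Λ * t ^ (-(1 / 2 : ℝ)) * (t / t') ^ ε) * w t' =
        ENNReal.ofReal (Λ * t ^ (ε - 1 / 2)) * ENNReal.ofReal (t' ^ (-(1 + ε - a))) := by
      intro t' ht'
      have ht'0 : 0 < t' := ht'.1
      rw [hw, ← ENNReal.ofReal_mul (by positivity), ← ENNReal.ofReal_mul (by positivity)]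
      congr 1
      rw [Real.div_rpow ht0.le ht'0.le, show (-(1 + ε - a) : ℝ) = -ε + (a - 1) by ring,
        Real.rpow_add ht'0, Real.rpow_neg ht'0.le, show (ε - 1 / 2 : ℝ) = -(1 / 2 : ℝ) + ε by ring,
        Real.rpow_add ht0]
      field_simp
    rw [setLIntegral_congr_fun measurableSet_Ioo heq, lintegral_const_mul' _ _ ENNReal.ofReal_ne_top,
      ← ofReal_integral_eq_lintegral_ofReal (integrableOn_rpow_Ioo (by linarith))
        ((ae_restrict_iff' measurableSet_Ioo).2 (Eventually.of_forall fun t' ht' =>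
          Real.rpow_nonneg ht'.1.le _)),
      setIntegral_Ioo_rpow_neg ht0.le (by linarith : (1 + ε - a : ℝ) < 1),
      ← ENNReal.ofReal_mul (by positivity)]
    refine ENNReal.ofReal_le_ofReal ?_
    have e1 : (1 - (1 + ε - a) : ℝ) = a - ε := by ring
    rw [e1]
    have hpow : t ^ (ε - 1 / 2) * t ^ (a - ε) = t ^ (a - 1 / 2) := by
      rw [← Real.rpow_add ht0]; ring_nf
    have haε : 0 < a - ε := by linarith
    have hinv : 1 / (a - ε) ≤ 2 / a := by
      rw [div_le_div_iff₀ haε ha]; nlinarith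
    calc Λ * t ^ (ε - 1 / 2) * (t ^ (a - ε) / (a - ε))
        = Λ * (t ^ (ε - 1 / 2) * t ^ (a - ε)) * (1 / (a - ε)) := by ring
      _ ≤ Λ * (t ^ (ε - 1 / 2) * t ^ (a - ε)) * (2 / a) := by
          refine mul_le_mul_of_nonneg_left hinv ?_
          rw [hpow]; positivity
      _ = 2 * Λ / a * t ^ (a - 1 / 2) := by rw [hpow]; ring
  calc ∑ n ∈ Finset.range N, (volterraK c ν)^[n] (powProfile a) t
      ≤ ∑ n ∈ Finset.range N, superpos c ν n w t := Finset.sum_le_sum fun n _ => h1 n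
    _ = ∫⁻ t' in Ioo 0 t, (∑ n ∈ Finset.range N, chain c ν n t' t) * w t' := h2
    _ ≤ ∫⁻ t' in Ioo 0 t, (ENNReal.ofReal ((t - t') ^ (-(1 / 2 : ℝ))) +
          ENNReal.ofReal (Λ * t ^ (-(1 / 2 : ℝ)) * (t / t') ^ ε)) * w t' :=
        setLIntegral_mono' measurableSet_Ioo fun t' ht' => mul_le_mul' (h3 t' ht') le_rfl
    _ = (∫⁻ t' in Ioo 0 t, ENNReal.ofReal ((t - t') ^ (-(1 / 2 : ℝ))) * w t') +
          ∫⁻ t' in Ioo 0 t, ENNReal.ofReal (Λ * t ^ (-(1 / 2 : ℝ)) * (t / t') ^ ε) * w t' := by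
        simp only [add_mul]
        exact lintegral_add_left ((((measurable_const.sub measurable_id).pow_const _).ennreal_ofReal).mul hwm) _
    _ ≤ ENNReal.ofReal ((2 / a + 4) * t ^ (a - 1 / 2)) + ENNReal.ofReal (2 * Λ / a * t ^ (a - 1 / 2)) :=
        add_le_add hI1 hI2
    _ = ENNReal.ofReal ((2 / a + 4 + 2 * Λ / a) * t ^ (a - 1 / 2)) := by
        rw [← ENNReal.ofReal_add (by positivity) (by positivity)]
        ring_nf

/-- The same bound for the full series `Σₙ Kⁿ p_a` (monotone convergence of the partial sums).
[cite: CoiculescuPalasek2025, Prop. 4.2 with the proof of Prop. 4.3] -/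
theorem tsum_iterate_volterraK_powProfile_le (hc : 0 < c) (hK₀ : 0 < K₀) (hC : 0 ≤ C) (hη : 0 ≤ η)
    (hνm : Measurable ν) (hνc : ContinuousOn ν (Ioc 0 T)) (hν0 : ∀ s ∈ Ioc 0 T, 0 ≤ ν s)
    (h313a : ∀ s ∈ Ioc 0 T, Real.sqrt s * ν s ≤ K₀)
    (h313b : ∀ t₁ t₂ : ℝ, 0 < t₁ → t₁ ≤ t₂ → t₂ ≤ T →
      ∫ s in t₁..t₂, (ν s ^ 2 + s ^ (-(1 / 2 : ℝ)) * ν s) ≤ C * (1 + η * Real.log (t₂ / t₁)))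
    {a : ℝ} (ha : 0 < a) (ha1 : a ≤ 1)
    (hε : ((3 * (c * (1 + 2731 * c ^ 2 * K₀) * C) + 1) * η) ≤ a / 2)
    {t : ℝ} (ht : t ∈ Ioc 0 T) :
    ∑' n, (volterraK c ν)^[n] (powProfile a) t ≤
      ENNReal.ofReal ((2 / a + 4 + 2 * (3 * (c * (10 * K₀ + Real.sqrt 2 * C)) *
        Real.exp (3 * (c * (1 + 2731 * c ^ 2 * K₀) * C))) / a) * t ^ (a - 1 / 2)) :=
  ENNReal.tsum_le_of_sum_range_le fun N =>
    sum_iterate_volterraK_powProfile_le hc hK₀ hC hη hνm hνc hν0 h313a h313b ha ha1 hε N ht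

end Estimates

end LacunaryVolterra

end Literature.Analysis.FluidPDE
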